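import Literature.NumberTheory.Sieve.BombieriAsymptoticSieveGeneralHyp
import Literature.NumberTheory.Sieve.BombieriAsymptoticSieveOscillation
import Literature.NumberTheory.Sieve.DivisorPowerSums
import HarnessLib

/-!
# Bombieri's asymptotic sieve under the hypotheses of `Literature.NumberTheory.Sieve.bombieri_asymptotic_sieve`: Lemma 12

Topic `Literature/NumberTheory/Sieve`, companion file of `BombieriAsymptoticSieve.lean`,
`BombieriAsymptoticSieveLemma12.lean`, `BombieriAsymptoticSieveOscillation.lean` and
`ParityBarrier.lean`. Everything here is PROVED (theorems only, no new definitions, no `sorry`).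

[FriedlanderIwaniecPisa1978] Lemma 12 evaluates
`Σ₁ = ∑_{n ≤ x, (n,P(z))=1} a_n ∑_{d ∣ n, d < y} μ(d)(log n/d)^k` as `H A(x) F + (error)` with
`F = P(z) ∑_{d<y,(d,P(z))=1} μ(d) d⁻¹ (log x/d)^k`. `BombieriAsymptoticSieveLemma12.lean` proves it
under Bombieri's axioms (A₁)–(A₅) (`FI1978_lemma12_holds`); here it is proved under the hypotheses
of the tree's `Literature.NumberTheory.Sieve.bombieri_asymptotic_sieve` (`ParityBarrier.lean`): size `X(x) = x`,
`HasSieveDimension g 1 K`, `HasLinearDensity c`, `HasDensityConstant H`, level of distribution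
`x^θ` for every `θ < 1` on SQUAREFREE moduli, and `∑_{n≤x} a_n² ≪ x(log x)^C` (`treeLemma12`, in
the shape consumed by the assembly of the theorem). Architecture as printed (pp. 738–739):
`Σ₁ = ∑_{d<y rough} μ(d) S(𝒜^{(d)}, z)` with the weighted subsequences
`a'_n = 1_{d∣n} a_n (log⁺ n/d)^k` (`sigma1_eq_sum_moebius_mul`, from `…Lemma12.lean`), the
fundamental lemma for each (`weighted_sifted_sub_le'`, model size `g(d) Φ_d(x)` with the INTEGER
sum `Φ_d(x) = ∑_{n ≤ x} (log⁺ n/d)^k`, since `X(x) = x`), remainders by Abel summation in sum form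
over the heights `t ≤ x` (`abs_weightedRemainder_le`, `weightedRemainders_le`), using the level of
distribution at `t ≥ x^{1−ε/2}` (`remainderSum_level_le`) and Cauchy–Schwarz with `∑ a_n²`,
`∑ τ(n)²` below (`remainderSum_trivial_le`); `Φ_d(x)` against `x ∫ (log t/d)^k`-type main term
(`abs_sum_logWeight_sub_le`); Lemma 9 replaced by the oscillatory estimate
`abs_sum_moebius_mul_density_sub_inv_le` of `BombieriAsymptoticSieveOscillation.lean`
(`abs_model_sub_le`), and `V(z)` against `H P(z)` through `HasDensityConstant`
(`abs_main_sub_mainTermF_le`). Everything explicit at a fixed height: `sigma1_bound_at`.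

## References

* J. Friedlander, H. Iwaniec, *On Bombieri's asymptotic sieve*, Ann. Scuola Norm. Sup. Pisa
  Cl. Sci. (4) 5 (1978), 719–756, Lemma 12 and pp. 738–739. [FriedlanderIwaniecPisa1978]
* E. Bombieri, *The asymptotic sieve*, Rend. Accad. Naz. XL (5) 1/2 (1975/76), 243–269.
  [BombieriAsymptoticSieve1976]
-/

open Filter Finset Asymptotics
open scoped Topology ArithmeticFunction.Moebius ArithmeticFunction.Omega ArithmeticFunction.sigma

noncomputable section

namespace Literature.NumberTheory.Sieve

namespace BombieriSieve

/-! ### The fundamental lemma for weighted subsequences with a model size -/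

/-- Variant of `weighted_sifted_sub_le` in which the size of the auxiliary sequence
`a'_n = 1_{d ∣ n} a_n w(n)` is an arbitrary model quantity `g(d) M`, `M ≥ 0` (for `X(x) = x` the
natural model is the integer sum `M = ∑_{n ≤ x} w(n)`): for `(d, P(z)) = 1`, `g(d) ≥ 0`, `w ≥ 0`,
`2 ≤ z ≤ D` and the fundamental lemma with constants `K, C_F`,
`|∑_{n ≤ x, (n,P(z))=1, d ∣ n} a_n w(n) − g(d) M V(z)| ≤ C_F g(d) M V(z) e^{−log D/log z} +
∑_{ν ∣ P(z), ν ≤ D} |∑_{n ≤ x, dν ∣ n} a_n w(n) − g(dν) M|`.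
[cite: FriedlanderIwaniecPisa1978, Lemma 12 (proof, p. 739)] -/
theorem weighted_sifted_sub_le' {K CF : ℝ}
    (hFL' : ∀ A : SieveSequence, HasSieveDimension A.density 1 K → ∀ x z D : ℝ, 2 ≤ z → z ≤ D →
      0 ≤ A.size x →
        |A.sifted x (primesProdBelow z) - A.size x * A.densityProduct (primesProdBelow z)| ≤
          CF * A.size x * A.densityProduct (primesProdBelow z) *
              Real.exp (-(Real.log D / Real.log z)) +
            ∑ d ∈ (primesProdBelow z).divisors.filter (fun d : ℕ => (d : ℝ) ≤ D),
              |A.remainder d x|)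
    (A : SieveSequence) (hK : HasSieveDimension A.density 1 K) {w : ℕ → ℝ} (hw : ∀ n, 0 ≤ w n)
    {d : ℕ} (hd : 0 ≤ A.density d) {z : ℝ} (hdP : d.Coprime (primesProdBelow z)) (x D : ℝ)
    {M : ℝ} (hM : 0 ≤ M) (hz : 2 ≤ z) (hzD : z ≤ D) :
    |(∑ n ∈ (Ioc 0 ⌊x⌋₊).filter (fun n : ℕ => n.Coprime (primesProdBelow z) ∧ d ∣ n),
          A.a n * w n) -
        A.density d * M * A.densityProduct (primesProdBelow z)| ≤
      CF * (A.density d * M) * A.densityProduct (primesProdBelow z) *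
          Real.exp (-(Real.log D / Real.log z)) +
        ∑ ν ∈ (primesProdBelow z).divisors.filter (fun ν : ℕ => (ν : ℝ) ≤ D),
          |(∑ n ∈ (Ioc 0 ⌊x⌋₊).filter (fun n : ℕ => d * ν ∣ n), A.a n * w n) -
              A.density (d * ν) * M| := by
  set P := primesProdBelow z with hP
  set A' : SieveSequence :=
    { a := fun n => (if d ∣ n then A.a n else 0) * w n
      a_nonneg := fun n => mul_nonneg (by split_ifs; exacts [A.a_nonneg n, le_rfl]) (hw n)
      size := fun _ => A.density d * M
      density := A.density
      density_mult := A.density_mult } with hA'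
  have hsz' : A'.size x = A.density d * M := by rw [hA']
  have hsz : 0 ≤ A'.size x := by rw [hsz']; exact mul_nonneg hd hM
  have h := hFL' A' hK x z D hz hzD hsz
  have h1 : A'.sifted x P =
      ∑ n ∈ (Ioc 0 ⌊x⌋₊).filter (fun n : ℕ => n.Coprime P ∧ d ∣ n), A.a n * w n := by
    rw [hA', SieveSequence.sifted]
    simp only [ite_mul, zero_mul]
    rw [Finset.sum_ite, Finset.sum_const_zero, add_zero, Finset.filter_filter]
  have h3 : A'.densityProduct P = A.densityProduct P := by rw [hA']; rfl
  have h4 : ∀ ν ∈ P.divisors.filter (fun ν : ℕ => (ν : ℝ) ≤ D), A'.remainder ν x =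
      (∑ n ∈ (Ioc 0 ⌊x⌋₊).filter (fun n : ℕ => d * ν ∣ n), A.a n * w n) -
        A.density (d * ν) * M := by
    intro ν hν
    have hνP : ν ∣ P := Nat.dvd_of_mem_divisors (Finset.mem_filter.mp hν).1
    have hdν : d.Coprime ν := hdP.coprime_dvd_right hνP
    rw [SieveSequence.remainder, hsz', hA', SieveSequence.congrSum]
    simp only [ite_mul, zero_mul]
    rw [Finset.sum_ite, Finset.sum_const_zero, add_zero, Finset.filter_filter,
      A.density_mult.map_mul_of_coprime hdν]
    have hfilter : (Ioc 0 ⌊x⌋₊).filter (fun n : ℕ => ν ∣ n ∧ d ∣ n) =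
        (Ioc 0 ⌊x⌋₊).filter (fun n : ℕ => d * ν ∣ n) := by
      refine Finset.filter_congr fun n _ => ⟨fun hh => hdν.mul_dvd_of_dvd_of_dvd hh.2 hh.1,
        fun hh => ⟨(dvd_mul_left ν d).trans hh, (dvd_mul_right d ν).trans hh⟩⟩
    rw [hfilter]
    show _ - A.density ν * (A.density d * M) = _ - A.density d * A.density ν * M
    ring
  have h5 : ∑ ν ∈ P.divisors.filter (fun ν : ℕ => (ν : ℝ) ≤ D), |A'.remainder ν x| =
      ∑ ν ∈ P.divisors.filter (fun ν : ℕ => (ν : ℝ) ≤ D),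
        |(∑ n ∈ (Ioc 0 ⌊x⌋₊).filter (fun n : ℕ => d * ν ∣ n), A.a n * w n) -
            A.density (d * ν) * M| :=
    Finset.sum_congr rfl fun ν hν => by rw [h4 ν hν]
  rw [← hP] at h
  rw [h1, hsz', h3, h5] at h
  exact h

/-! ### Remainders of the weighted subsequences by Abel summation (size `X(x) = x`) -/

/-- **Abel summation for the weighted remainders, `X(x) = x`** ("Partial summation (twice)" of
[FriedlanderIwaniecPisa1978] p. 739, in the form needed when only the level of distribution
WITHOUT a supremum over `t ≤ x` is available): for a modulus `q`, a nondecreasing weight `w ≥ 0`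
and `N`, `|∑_{n ≤ N, q ∣ n} a_n w(n) − g(q) ∑_{n ≤ N} w(n)| ≤ w(N) |R_q(N)| +
∑_{m < N} (w(m+1) − w(m)) |R_q(m)|`, where `R_q(t) = A_q(t) − g(q) t`.
[cite: FriedlanderIwaniecPisa1978, Lemma 12 (proof, p. 739)] -/
theorem abs_weightedRemainder_le (A : SieveSequence) (hsize : ∀ x, A.size x = x)
    {w : ℕ → ℝ} (hw0 : ∀ n, 0 ≤ w n) (hw : Monotone w) (q N : ℕ) :
    |(∑ n ∈ (Ioc 0 N).filter (fun n : ℕ => q ∣ n), A.a n * w n) -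
        A.density q * ∑ n ∈ Ioc 0 N, w n| ≤
      w N * |A.remainder q (N : ℝ)| +
        ∑ m ∈ Finset.range N, (w (m + 1) - w m) * |A.remainder q (m : ℝ)| := by
  set e : ℕ → ℝ := fun n => (if q ∣ n then A.a n else 0) - A.density q with he
  have hsum : (∑ n ∈ (Ioc 0 N).filter (fun n : ℕ => q ∣ n), A.a n * w n) -
      A.density q * ∑ n ∈ Ioc 0 N, w n = ∑ n ∈ Ioc 0 N, e n * w n := by
    rw [Finset.sum_filter, Finset.mul_sum, ← Finset.sum_sub_distrib]
    refine Finset.sum_congr rfl fun n _ => ?_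
    simp only [he]
    split_ifs <;> ring
  have hpartial : ∀ m : ℕ, ∑ n ∈ Ioc 0 m, e n = A.remainder q (m : ℝ) := by
    intro m
    rw [SieveSequence.remainder, hsize, SieveSequence.congrSum, Nat.floor_natCast,
      Finset.sum_filter, he, Finset.sum_sub_distrib, Finset.sum_const, Nat.card_Ioc,
      nsmul_eq_mul, Nat.sub_zero]
    ring
  rw [hsum, sum_Ioc_mul_eq_sub_sum_range]
  simp_rw [hpartial]
  calc |A.remainder q (N : ℝ) * w N -
        ∑ m ∈ Finset.range N, A.remainder q (m : ℝ) * (w (m + 1) - w m)|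
      ≤ |A.remainder q (N : ℝ) * w N| +
          |∑ m ∈ Finset.range N, A.remainder q (m : ℝ) * (w (m + 1) - w m)| := abs_sub _ _
    _ ≤ w N * |A.remainder q (N : ℝ)| +
          ∑ m ∈ Finset.range N, (w (m + 1) - w m) * |A.remainder q (m : ℝ)| := by
        refine add_le_add ?_ ((Finset.abs_sum_le_sum_abs _ _).trans (Finset.sum_le_sum
          fun m _ => ?_))
        · rw [abs_mul, abs_of_nonneg (hw0 N), mul_comm]
        · rw [abs_mul, abs_of_nonneg (sub_nonneg.mpr (hw (Nat.le_succ m))), mul_comm]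

/-- `u^k − v^k ≤ k u^{k−1} (u − v)` for `0 ≤ v ≤ u`. [folklore] -/
theorem pow_sub_pow_le_mul {u v : ℝ} (hv0 : 0 ≤ v) (hvu : v ≤ u) (k : ℕ) :
    u ^ k - v ^ k ≤ k * u ^ (k - 1) * (u - v) := by
  have hu0 : 0 ≤ u := hv0.trans hvu
  have hgeom := geom_sum₂_mul u v k
  have hS : ∑ i ∈ Finset.range k, u ^ i * v ^ (k - 1 - i) ≤ k * u ^ (k - 1) := by
    have hterm : ∀ i ∈ Finset.range k, u ^ i * v ^ (k - 1 - i) ≤ u ^ (k - 1) := by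
      intro i hi
      have hik : i + (k - 1 - i) = k - 1 := by
        have := Finset.mem_range.mp hi
        omega
      calc u ^ i * v ^ (k - 1 - i) ≤ u ^ i * u ^ (k - 1 - i) :=
            mul_le_mul_of_nonneg_left (pow_le_pow_left₀ hv0 hvu _) (pow_nonneg hu0 _)
        _ = u ^ (k - 1) := by rw [← pow_add, hik]
    refine (Finset.sum_le_sum hterm).trans ?_
    rw [Finset.sum_const, Finset.card_range, nsmul_eq_mul]
  calc u ^ k - v ^ k = (∑ i ∈ Finset.range k, u ^ i * v ^ (k - 1 - i)) * (u - v) := hgeom.symm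
    _ ≤ k * u ^ (k - 1) * (u - v) := mul_le_mul_of_nonneg_right hS (sub_nonneg.mpr hvu)

/-- `max 0 b − max 0 a ≤ b − a` for `a ≤ b` (`max(0, ·)` is `1`-Lipschitz and monotone).
[folklore] -/
theorem max_zero_sub_max_zero_le {a b : ℝ} (hab : a ≤ b) : max 0 b - max 0 a ≤ b - a := by
  rcases le_or_gt 0 a with ha | ha
  · rw [max_eq_right ha, max_eq_right (ha.trans hab)]
  · rw [max_eq_left ha.le]
    rcases le_or_gt 0 b with hb | hb
    · rw [max_eq_right hb]; linarith
    · rw [max_eq_left hb.le]; linarith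

/-- Increments of the weight `φ_d(m) = (log⁺ (m/d))^k`, `d ≥ 1`: for `m + 1 ≤ x`,
`φ_d(m+1) − φ_d(m) ≤ k (log x)^{k−1} (log (m+1) − log m)` (at `m = 0` both sides vanish,
`log 0 = 0`). [folklore] -/
theorem logWeight_succ_sub_le (k : ℕ) {d m : ℕ} {x : ℝ} (hd : 1 ≤ d) (hmx : (m : ℝ) + 1 ≤ x) :
    max 0 (Real.log (((m + 1 : ℕ) : ℝ) / d)) ^ k - max 0 (Real.log ((m : ℝ) / d)) ^ k ≤
      k * Real.log x ^ (k - 1) * (Real.log ((m : ℝ) + 1) - Real.log m) := by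
  have hd0 : (0 : ℝ) < d := by exact_mod_cast hd
  have hd1 : (1 : ℝ) ≤ d := by exact_mod_cast hd
  have hx1 : 1 ≤ x := by
    have : (0 : ℝ) ≤ m := Nat.cast_nonneg m
    linarith
  have hL0 : 0 ≤ Real.log x := Real.log_nonneg hx1
  rcases Nat.eq_zero_or_pos m with rfl | hm
  · -- `m = 0`: both weights vanish
    have h1 : max 0 (Real.log (((0 + 1 : ℕ) : ℝ) / d)) = 0 := by
      refine max_eq_left ?_
      push_cast
      rw [one_div, Real.log_inv, neg_nonpos]
      exact Real.log_nonneg hd1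
    have h2 : max 0 (Real.log (((0 : ℕ) : ℝ) / d)) = 0 := by simp
    rw [h1, h2, sub_self]
    push_cast
    rw [zero_add, Real.log_one, Real.log_zero, sub_zero, mul_zero]
  · have hm0 : (0 : ℝ) < m := by exact_mod_cast hm
    set u := max 0 (Real.log (((m + 1 : ℕ) : ℝ) / d)) with hu
    set v := max 0 (Real.log ((m : ℝ) / d)) with hv
    have hv0 : 0 ≤ v := le_max_left _ _
    have hcast : (((m + 1 : ℕ) : ℝ)) = (m : ℝ) + 1 := by push_cast; ring
    have hle_arg : (m : ℝ) / d ≤ ((m + 1 : ℕ) : ℝ) / d := by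
      rw [hcast]; exact div_le_div_of_nonneg_right (by linarith) hd0.le
    have hvu : v ≤ u := max_le_max le_rfl (Real.log_le_log (by positivity) hle_arg)
    have hule : u ≤ Real.log x := by
      refine max_le hL0 ?_
      calc Real.log (((m + 1 : ℕ) : ℝ) / d) ≤ Real.log (((m + 1 : ℕ) : ℝ)) :=
            Real.log_le_log (by positivity) (div_le_self (by positivity) hd1)
        _ ≤ Real.log x := Real.log_le_log (by positivity) (by rw [hcast]; exact hmx)
    have huv : u - v ≤ Real.log ((m : ℝ) + 1) - Real.log m := by
      have h := max_zero_sub_max_zero_le (Real.log_le_log (by positivity) hle_arg)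
      rw [← hu, ← hv] at h
      refine h.trans (le_of_eq ?_)
      rw [hcast, Real.log_div (by positivity) hd0.ne', Real.log_div hm0.ne' hd0.ne']
      ring
    have hu0 : 0 ≤ u := hv0.trans hvu
    calc u ^ k - v ^ k ≤ k * u ^ (k - 1) * (u - v) := pow_sub_pow_le_mul hv0 hvu k
      _ ≤ k * Real.log x ^ (k - 1) * (Real.log ((m : ℝ) + 1) - Real.log m) := by
          refine mul_le_mul (mul_le_mul_of_nonneg_left (pow_le_pow_left₀ hu0 hule _)
            (Nat.cast_nonneg k)) huv (sub_nonneg.mpr hvu) ?_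
          exact mul_nonneg (Nat.cast_nonneg k) (pow_nonneg hL0 _)

/-- `φ_d(n) ≤ (log x)^k` for `n ≤ x`, `d ≥ 1`. [folklore] -/
theorem logWeight_le_pow_log (k : ℕ) {d n : ℕ} {x : ℝ} (hd : 1 ≤ d) (hx : 1 ≤ x)
    (hnx : (n : ℝ) ≤ x) : max 0 (Real.log ((n : ℝ) / d)) ^ k ≤ Real.log x ^ k := by
  have hd0 : (0 : ℝ) < d := by exact_mod_cast hd
  have hd1 : (1 : ℝ) ≤ d := by exact_mod_cast hd
  have hL0 : 0 ≤ Real.log x := Real.log_nonneg hx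
  refine pow_le_pow_left₀ (le_max_left _ _) (max_le hL0 ?_) k
  rcases Nat.eq_zero_or_pos n with rfl | hn
  · simp [hL0]
  · have hn0 : (0 : ℝ) < n := by exact_mod_cast hn
    calc Real.log ((n : ℝ) / d) ≤ Real.log n :=
          Real.log_le_log (by positivity) (div_le_self hn0.le hd1)
      _ ≤ Real.log x := Real.log_le_log hn0 hnx

/-- `∑_{m < T} m (log (m+1) − log m) ≤ T` (each term is `m log(1 + 1/m) ≤ 1`). [folklore] -/
theorem sum_range_mul_log_succ_sub_le (T : ℕ) :
    ∑ m ∈ Finset.range T, (m : ℝ) * (Real.log ((m : ℝ) + 1) - Real.log m) ≤ T := by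
  have hterm : ∀ m ∈ Finset.range T, (m : ℝ) * (Real.log ((m : ℝ) + 1) - Real.log m) ≤ 1 := by
    intro m _
    rcases Nat.eq_zero_or_pos m with rfl | hm
    · simp
    · have hm0 : (0 : ℝ) < m := by exact_mod_cast hm
      have h1 : Real.log ((m : ℝ) + 1) - Real.log m = Real.log (1 + (m : ℝ)⁻¹) := by
        rw [← Real.log_div (by positivity) hm0.ne']
        congr 1
        field_simp
      rw [h1]
      have h2 : Real.log (1 + (m : ℝ)⁻¹) ≤ (m : ℝ)⁻¹ := by
        have := Real.log_le_sub_one_of_pos (show 0 < 1 + (m : ℝ)⁻¹ by positivity)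
        linarith
      calc (m : ℝ) * Real.log (1 + (m : ℝ)⁻¹) ≤ (m : ℝ) * (m : ℝ)⁻¹ :=
            mul_le_mul_of_nonneg_left h2 hm0.le
        _ = 1 := mul_inv_cancel₀ hm0.ne'
  calc ∑ m ∈ Finset.range T, (m : ℝ) * (Real.log ((m : ℝ) + 1) - Real.log m)
      ≤ ∑ m ∈ Finset.range T, (1 : ℝ) := Finset.sum_le_sum hterm
    _ = T := by simp

/-- `∑_{m < N} (log (m+1) − log m) = log N` (`log 0 = 0`). [folklore] -/
theorem sum_range_log_succ_sub (N : ℕ) :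
    ∑ m ∈ Finset.range N, (Real.log ((m : ℝ) + 1) - Real.log m) = Real.log N := by
  have h := Finset.sum_range_sub (fun m : ℕ => Real.log (m : ℝ)) N
  simp only [Nat.cast_zero, Real.log_zero, sub_zero] at h
  rw [← h]
  refine Finset.sum_congr rfl fun m _ => ?_
  push_cast
  ring

/-- `∑_{n ≤ N} (log x − log n) ≤ 2N` for `N = ⌊x⌋`, `x ≥ 1` (`log N! ≥ N log N − N` and
`log x − log N ≤ log 2 ≤ 1`). [folklore] -/
theorem sum_log_sub_log_le {x : ℝ} (hx : 1 ≤ x) :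
    ∑ n ∈ Ioc 0 ⌊x⌋₊, (Real.log x - Real.log n) ≤ 2 * ⌊x⌋₊ := by
  set N := ⌊x⌋₊ with hN
  have hN1 : 1 ≤ N := Nat.le_floor (by rw [Nat.cast_one]; exact hx)
  have hN0 : (0 : ℝ) < N := by exact_mod_cast hN1
  have hx0 : 0 < x := by linarith
  rw [Finset.sum_sub_distrib, Finset.sum_const, Nat.card_Ioc, Nat.sub_zero, nsmul_eq_mul,
    ← SelbergSymmetry.log_factorial_eq_sum_log]
  have hfact := SelbergSymmetry.log_factorial_ge (N := N) (by omega)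
  have hxN : Real.log x - Real.log N ≤ 1 := by
    have h2N : x ≤ 2 * N := by
      have := Nat.lt_floor_add_one x
      rw [← hN] at this
      have : (1 : ℝ) ≤ N := by exact_mod_cast hN1
      linarith
    rw [← Real.log_div hx0.ne' hN0.ne']
    calc Real.log (x / N) ≤ Real.log 2 := Real.log_le_log (by positivity) (by
          rw [div_le_iff₀ hN0]; linarith)
      _ ≤ 1 := by
          have := Real.log_two_lt_d9; norm_num at this; linarith
  nlinarith

/-! ### The integer weighted sums `Φ_d(x) = ∑_{n ≤ x} φ_d(n)` -/

/-- **The model weighted sum against `x (log x/d)^k`**: for `1 ≤ d ≤ x`, `x ≥ 2`,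
`|∑_{n ≤ x} (log⁺ n/d)^k − x (log x/d)^k| ≤ (2k + 1) x (log x)^{k−1}` (pointwise
`0 ≤ (log x/d)^k − φ_d(n) ≤ k (log x)^{k−1}(log x − log n)`, `∑_{n≤x}(log x − log n) ≤ 2x`, and
`(x − ⌊x⌋)(log x/d)^k ≤ (log x)^k ≤ x (log x)^{k−1}`). [folklore] -/
theorem abs_sum_logWeight_sub_le {k d : ℕ} (hk : 1 ≤ k) {x : ℝ} (hx : 2 ≤ x) (hd : 1 ≤ d)
    (hdx : (d : ℝ) ≤ x) :
    |(∑ n ∈ Ioc 0 ⌊x⌋₊, max 0 (Real.log ((n : ℝ) / d)) ^ k) - x * Real.log (x / d) ^ k| ≤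
      (2 * k + 1) * x * Real.log x ^ (k - 1) := by
  set N := ⌊x⌋₊ with hN
  have hx0 : 0 < x := by linarith
  have hx1 : 1 ≤ x := by linarith
  have hd0 : (0 : ℝ) < d := by exact_mod_cast hd
  have hL0 : 0 < Real.log x := Real.log_pos (by linarith)
  have hNx : (N : ℝ) ≤ x := Nat.floor_le hx0.le
  have hxN : x - N ≤ 1 := by have := Nat.lt_floor_add_one x; rw [← hN] at this; linarith
  have hN0 : (0 : ℝ) ≤ N := Nat.cast_nonneg N
  have hlogxd : 0 ≤ Real.log (x / d) := Real.log_nonneg ((one_le_div hd0).mpr hdx)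
  have hlogxd' : Real.log (x / d) ≤ Real.log x := by
    rw [Real.log_div hx0.ne' hd0.ne']
    linarith [Real.log_nonneg (show (1 : ℝ) ≤ d by exact_mod_cast hd)]
  -- pointwise bounds summed
  have hpt : ∀ n ∈ Ioc 0 N, 0 ≤ Real.log (x / d) ^ k - max 0 (Real.log ((n : ℝ) / d)) ^ k ∧
      Real.log (x / d) ^ k - max 0 (Real.log ((n : ℝ) / d)) ^ k ≤
        k * Real.log x ^ (k - 1) * (Real.log x - Real.log n) := by
    intro n hn
    obtain ⟨hn0, hnN⟩ := Finset.mem_Ioc.mp hn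
    exact pow_log_sub_logWeight_bounds hd hdx hn0 ((Nat.cast_le.mpr hnN).trans hNx)
  have hsum1 : 0 ≤ N * Real.log (x / d) ^ k - ∑ n ∈ Ioc 0 N, max 0 (Real.log ((n : ℝ) / d)) ^ k ∧
      N * Real.log (x / d) ^ k - ∑ n ∈ Ioc 0 N, max 0 (Real.log ((n : ℝ) / d)) ^ k ≤
        k * Real.log x ^ (k - 1) * (2 * N) := by
    have heq : N * Real.log (x / d) ^ k - ∑ n ∈ Ioc 0 N, max 0 (Real.log ((n : ℝ) / d)) ^ k =
        ∑ n ∈ Ioc 0 N, (Real.log (x / d) ^ k - max 0 (Real.log ((n : ℝ) / d)) ^ k) := by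
      rw [Finset.sum_sub_distrib, Finset.sum_const, Nat.card_Ioc, Nat.sub_zero, nsmul_eq_mul]
    rw [heq]
    refine ⟨Finset.sum_nonneg fun n hn => (hpt n hn).1, ?_⟩
    calc ∑ n ∈ Ioc 0 N, (Real.log (x / d) ^ k - max 0 (Real.log ((n : ℝ) / d)) ^ k)
        ≤ ∑ n ∈ Ioc 0 N, k * Real.log x ^ (k - 1) * (Real.log x - Real.log n) :=
          Finset.sum_le_sum fun n hn => (hpt n hn).2
      _ = k * Real.log x ^ (k - 1) * ∑ n ∈ Ioc 0 N, (Real.log x - Real.log n) := by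
          rw [Finset.mul_sum]
      _ ≤ k * Real.log x ^ (k - 1) * (2 * N) :=
          mul_le_mul_of_nonneg_left (sum_log_sub_log_le hx1) (by positivity)
  -- `(x − N)(log x/d)^k ≤ (log x)^k ≤ x (log x)^{k−1}`
  have hLx : Real.log x ≤ x := (Real.log_le_sub_one_of_pos hx0).trans (by linarith)
  have hpowk : Real.log x ^ k ≤ x * Real.log x ^ (k - 1) := by
    obtain ⟨j, rfl⟩ : ∃ j, k = j + 1 := ⟨k - 1, by omega⟩
    rw [Nat.add_sub_cancel, pow_succ, mul_comm]
    exact mul_le_mul_of_nonneg_right hLx (pow_nonneg hL0.le _)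
  have h2 : |x * Real.log (x / d) ^ k - N * Real.log (x / d) ^ k| ≤ x * Real.log x ^ (k - 1) := by
    rw [← sub_mul, abs_of_nonneg (mul_nonneg (by linarith) (pow_nonneg hlogxd _))]
    calc (x - N) * Real.log (x / d) ^ k ≤ 1 * Real.log x ^ k :=
          mul_le_mul hxN (pow_le_pow_left₀ hlogxd hlogxd' k) (pow_nonneg hlogxd _) zero_le_one
      _ = Real.log x ^ k := one_mul _
      _ ≤ x * Real.log x ^ (k - 1) := hpowk
  obtain ⟨h1a, h1b⟩ := hsum1
  have hkL : 0 ≤ (k : ℝ) * Real.log x ^ (k - 1) := by positivity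
  have hNx' : (k : ℝ) * Real.log x ^ (k - 1) * (2 * N) ≤ k * Real.log x ^ (k - 1) * (2 * x) :=
    mul_le_mul_of_nonneg_left (by linarith) hkL
  have hkx : 0 ≤ (k : ℝ) * Real.log x ^ (k - 1) * x := mul_nonneg hkL hx0.le
  obtain ⟨h2a, h2b⟩ := abs_le.mp h2
  rw [abs_le]
  constructor
  · nlinarith
  · nlinarith

/-- `0 ≤ Φ_d ≤ x (log x)^k`. [folklore] -/
theorem sum_logWeight_le {k d : ℕ} {x : ℝ} (hx : 1 ≤ x) (hd : 1 ≤ d) :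
    0 ≤ ∑ n ∈ Ioc 0 ⌊x⌋₊, max 0 (Real.log ((n : ℝ) / d)) ^ k ∧
      ∑ n ∈ Ioc 0 ⌊x⌋₊, max 0 (Real.log ((n : ℝ) / d)) ^ k ≤ x * Real.log x ^ k := by
  have hx0 : 0 < x := by linarith
  refine ⟨Finset.sum_nonneg fun n _ => pow_nonneg (le_max_left _ _) _, ?_⟩
  have hterm : ∀ n ∈ Ioc 0 ⌊x⌋₊, max 0 (Real.log ((n : ℝ) / d)) ^ k ≤ Real.log x ^ k := fun n hn =>
    logWeight_le_pow_log k hd hx ((Nat.cast_le.mpr (Finset.mem_Ioc.mp hn).2).trans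
      (Nat.floor_le hx0.le))
  calc ∑ n ∈ Ioc 0 ⌊x⌋₊, max 0 (Real.log ((n : ℝ) / d)) ^ k
      ≤ ∑ n ∈ Ioc 0 ⌊x⌋₊, Real.log x ^ k := Finset.sum_le_sum hterm
    _ = ⌊x⌋₊ * Real.log x ^ k := by rw [Finset.sum_const, Nat.card_Ioc, Nat.sub_zero, nsmul_eq_mul]
    _ ≤ x * Real.log x ^ k :=
        mul_le_mul_of_nonneg_right (Nat.floor_le hx0.le) (pow_nonneg (Real.log_nonneg hx) _)

/-! ### The remainders: rearrangement and the two ranges of `t` -/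

/-- **The total remainder of Lemma 12 for `X(x) = x`.** With `φ_d(n) = (log⁺ n/d)^k`,
`R'_{d,ν} = ∑_{n ≤ N, dν ∣ n} a_n φ_d(n) − g(dν) Φ_d` (`N = ⌊x⌋`), moduli `d` rough, squarefree,
`1 ≤ d < ⌈y⌉`, `ν ∣ P(z)`, `ν ≤ D₀`, all `d D₀ < L'`: if the squarefree remainder sums
`RS(t) = ∑_{q < ⌈L'⌉, q squarefree} |R_q(t)|` satisfy `RS(t) ≤ t Γ` for `t < t₀` and
`RS(t) ≤ R_big` for `t₀ ≤ t ≤ N`, then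
`∑_{d} ∑_{ν} |R'_{d,ν}| ≤ (log x)^k R_big + k (log x)^{k−1} (Γ t₀ + R_big log N)`
(Abel summation in the form `abs_weightedRemainder_le`, the moduli `dν` being distinct and
squarefree, `sum_coprime_sum_divisors_le`). [cite: FriedlanderIwaniecPisa1978, Lemma 12 (proof, p. 739)] -/
theorem weightedRemainders_le (A : SieveSequence) (hsize : ∀ x, A.size x = x) (k : ℕ)
    {x y z D₀ L' Γ Rbig : ℝ} (hx : 1 ≤ x) (hΓ : 0 ≤ Γ) {t₀ : ℕ}
    (hL' : ∀ d ∈ (Ico 1 ⌈y⌉₊).filter (fun d : ℕ => d.Coprime (primesProdBelow z)),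
      (d : ℝ) * D₀ < L')
    (hsmall : ∀ t : ℕ, 1 ≤ t → t < t₀ →
      ∑ q ∈ (Ico 1 ⌈L'⌉₊).filter Squarefree, |A.remainder q (t : ℝ)| ≤ t * Γ)
    (hbig : ∀ t : ℕ, t₀ ≤ t → t ≤ ⌊x⌋₊ →
      ∑ q ∈ (Ico 1 ⌈L'⌉₊).filter Squarefree, |A.remainder q (t : ℝ)| ≤ Rbig)
    (ht₀N : t₀ ≤ ⌊x⌋₊) :
    ∑ d ∈ ((Ico 1 ⌈y⌉₊).filter (fun d : ℕ => d.Coprime (primesProdBelow z))).filter Squarefree,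
      ∑ ν ∈ (primesProdBelow z).divisors.filter (fun ν : ℕ => (ν : ℝ) ≤ D₀),
        |(∑ n ∈ (Ioc 0 ⌊x⌋₊).filter (fun n : ℕ => d * ν ∣ n),
            A.a n * max 0 (Real.log ((n : ℝ) / d)) ^ k) -
          A.density (d * ν) * ∑ n ∈ Ioc 0 ⌊x⌋₊, max 0 (Real.log ((n : ℝ) / d)) ^ k| ≤
      Real.log x ^ k * Rbig + k * Real.log x ^ (k - 1) * (Γ * t₀ + Rbig * Real.log ⌊x⌋₊) := by
  set N := ⌊x⌋₊ with hN
  set P := primesProdBelow z with hP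
  set Dsf := ((Ico 1 ⌈y⌉₊).filter (fun d : ℕ => d.Coprime P)).filter Squarefree with hDsf
  set Nu := P.divisors.filter (fun ν : ℕ => (ν : ℝ) ≤ D₀) with hNu
  set RS : ℕ → ℝ := fun t => ∑ q ∈ (Ico 1 ⌈L'⌉₊).filter Squarefree, |A.remainder q (t : ℝ)|
    with hRS
  set c : ℕ → ℝ := fun m => k * Real.log x ^ (k - 1) * (Real.log ((m : ℝ) + 1) - Real.log m)
    with hc
  have hx0 : 0 < x := by linarith
  have hL0 : 0 ≤ Real.log x := Real.log_nonneg hx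
  have hNx : (N : ℝ) ≤ x := Nat.floor_le hx0.le
  have hmemD : ∀ {d : ℕ}, d ∈ Dsf → 1 ≤ d ∧ d.Coprime P ∧ Squarefree d := by
    intro d hd
    rw [hDsf, Finset.mem_filter, Finset.mem_filter, Finset.mem_Ico] at hd
    exact ⟨hd.1.1.1, hd.1.2, hd.2⟩
  -- Step 1: Abel summation for each `(d, ν)`
  have hstep1 : ∀ d ∈ Dsf, ∀ ν ∈ Nu,
      |(∑ n ∈ (Ioc 0 N).filter (fun n : ℕ => d * ν ∣ n),
          A.a n * max 0 (Real.log ((n : ℝ) / d)) ^ k) -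
        A.density (d * ν) * ∑ n ∈ Ioc 0 N, max 0 (Real.log ((n : ℝ) / d)) ^ k| ≤
      Real.log x ^ k * |A.remainder (d * ν) (N : ℝ)| +
        ∑ m ∈ Finset.range N, c m * |A.remainder (d * ν) (m : ℝ)| := by
    intro d hd ν _
    obtain ⟨hd1, -, -⟩ := hmemD hd
    obtain ⟨hw0, hwmono, -⟩ := logWeight_props k hd1
      (w := fun n => max 0 (Real.log ((n : ℝ) / d)) ^ k) (fun n => rfl)
    refine (abs_weightedRemainder_le A hsize hw0 hwmono (d * ν) N).trans ?_
    refine add_le_add ?_ (Finset.sum_le_sum fun m hm => ?_)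
    · exact mul_le_mul_of_nonneg_right (logWeight_le_pow_log k hd1 hx hNx) (abs_nonneg _)
    · refine mul_le_mul_of_nonneg_right ?_ (abs_nonneg _)
      have hm1x : (m : ℝ) + 1 ≤ x := by
        have : m + 1 ≤ N := Finset.mem_range.mp hm
        have : ((m + 1 : ℕ) : ℝ) ≤ N := by exact_mod_cast this
        push_cast at this; linarith
      exact logWeight_succ_sub_le k hd1 hm1x
  -- Step 2: sum over `(d, ν)` and interchange
  have hpair : ∀ t : ℕ, ∑ d ∈ Dsf, ∑ ν ∈ Nu, |A.remainder (d * ν) (t : ℝ)| ≤ RS t := by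
    intro t
    set f : ℕ → ℝ := fun q => if Squarefree q then |A.remainder q (t : ℝ)| else 0 with hf
    have hf0 : ∀ q, 0 ≤ f q := fun q => by rw [hf]; simp only; split_ifs <;> simp
    have hMs : ∀ d ∈ Dsf, d ≠ 0 ∧ d.Coprime P := fun d hd =>
      ⟨by have := (hmemD hd).1; omega, (hmemD hd).2.1⟩
    have hLd : ∀ d ∈ Dsf, (d : ℝ) * D₀ < L' := fun d hd =>
      hL' d (Finset.mem_filter.mp hd).1
    have heq : ∑ d ∈ Dsf, ∑ ν ∈ Nu, |A.remainder (d * ν) (t : ℝ)| =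
        ∑ d ∈ Dsf, ∑ ν ∈ Nu, f (d * ν) := by
      refine Finset.sum_congr rfl fun d hd => Finset.sum_congr rfl fun ν hν => ?_
      obtain ⟨-, hdP, hdsf⟩ := hmemD hd
      have hνP : ν ∣ P := Nat.dvd_of_mem_divisors (Finset.mem_filter.mp hν).1
      have hνsf : Squarefree ν := (squarefree_primesProdBelow z).squarefree_of_dvd (hP ▸ hνP)
      have hdν : Squarefree (d * ν) :=
        Nat.squarefree_mul_iff.mpr ⟨hdP.coprime_dvd_right hνP, hdsf, hνsf⟩
      rw [hf]; simp only; rw [if_pos hdν]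
    rw [heq]
    refine (sum_coprime_sum_divisors_le (hP ▸ primesProdBelow_ne_zero z) f hf0 _ hMs D₀ L'
      hLd).trans (le_of_eq ?_)
    rw [hRS, hf]
    simp only
    rw [Finset.sum_filter]
  have hc0 : ∀ m, 0 ≤ c m := by
    intro m
    rw [hc]; simp only
    refine mul_nonneg (by positivity) (sub_nonneg.mpr ?_)
    rcases Nat.eq_zero_or_pos m with rfl | hm
    · simp
    · exact Real.log_le_log (by exact_mod_cast hm) (by linarith)
  calc ∑ d ∈ Dsf, ∑ ν ∈ Nu,
        |(∑ n ∈ (Ioc 0 N).filter (fun n : ℕ => d * ν ∣ n),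
            A.a n * max 0 (Real.log ((n : ℝ) / d)) ^ k) -
          A.density (d * ν) * ∑ n ∈ Ioc 0 N, max 0 (Real.log ((n : ℝ) / d)) ^ k|
      ≤ ∑ d ∈ Dsf, ∑ ν ∈ Nu, (Real.log x ^ k * |A.remainder (d * ν) (N : ℝ)| +
          ∑ m ∈ Finset.range N, c m * |A.remainder (d * ν) (m : ℝ)|) :=
        Finset.sum_le_sum fun d hd => Finset.sum_le_sum fun ν hν => hstep1 d hd ν hν
    _ = Real.log x ^ k * ∑ d ∈ Dsf, ∑ ν ∈ Nu, |A.remainder (d * ν) (N : ℝ)| +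
          ∑ m ∈ Finset.range N, c m * ∑ d ∈ Dsf, ∑ ν ∈ Nu, |A.remainder (d * ν) (m : ℝ)| := by
        have e1 : ∑ d ∈ Dsf, ∑ ν ∈ Nu, (Real.log x ^ k * |A.remainder (d * ν) (N : ℝ)| +
            ∑ m ∈ Finset.range N, c m * |A.remainder (d * ν) (m : ℝ)|) =
            Real.log x ^ k * ∑ d ∈ Dsf, ∑ ν ∈ Nu, |A.remainder (d * ν) (N : ℝ)| +
              ∑ d ∈ Dsf, ∑ ν ∈ Nu, ∑ m ∈ Finset.range N, c m * |A.remainder (d * ν) (m : ℝ)| := by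
          rw [Finset.mul_sum, ← Finset.sum_add_distrib]
          refine Finset.sum_congr rfl fun d _ => ?_
          rw [Finset.mul_sum, ← Finset.sum_add_distrib]
        have e3 : ∑ d ∈ Dsf, ∑ ν ∈ Nu, ∑ m ∈ Finset.range N, c m * |A.remainder (d * ν) (m : ℝ)| =
            ∑ d ∈ Dsf, ∑ m ∈ Finset.range N, ∑ ν ∈ Nu, c m * |A.remainder (d * ν) (m : ℝ)| :=
          Finset.sum_congr rfl fun d _ => Finset.sum_comm
        have e2 : ∑ d ∈ Dsf, ∑ ν ∈ Nu, ∑ m ∈ Finset.range N, c m * |A.remainder (d * ν) (m : ℝ)| =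
            ∑ m ∈ Finset.range N, c m * ∑ d ∈ Dsf, ∑ ν ∈ Nu, |A.remainder (d * ν) (m : ℝ)| := by
          rw [e3, Finset.sum_comm]
          refine Finset.sum_congr rfl fun m _ => ?_
          rw [Finset.mul_sum]
          refine Finset.sum_congr rfl fun d _ => ?_
          rw [Finset.mul_sum]
        rw [e1, ← e2]
    _ ≤ Real.log x ^ k * RS N + ∑ m ∈ Finset.range N, c m * RS m := by
        refine add_le_add (mul_le_mul_of_nonneg_left (hpair N) (pow_nonneg hL0 _))
          (Finset.sum_le_sum fun m _ => mul_le_mul_of_nonneg_left (hpair m) (hc0 m))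
    _ ≤ Real.log x ^ k * Rbig + k * Real.log x ^ (k - 1) * (Γ * t₀ + Rbig * Real.log N) := by
        refine add_le_add (mul_le_mul_of_nonneg_left (hbig N ht₀N le_rfl) (pow_nonneg hL0 _)) ?_
        -- Step 3: the two ranges of `m`
        have hRbig : 0 ≤ Rbig :=
          le_trans (Finset.sum_nonneg fun q _ => abs_nonneg _) (hbig t₀ le_rfl ht₀N)
        have hRS0 : RS 0 = 0 := by
          rw [hRS]; simp only
          refine Finset.sum_eq_zero fun q _ => ?_
          rw [SieveSequence.remainder, SieveSequence.congrSum, hsize]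
          simp
        have hterm : ∀ m ∈ Finset.range N, c m * RS m ≤
            k * Real.log x ^ (k - 1) *
              (Γ * (if m < t₀ then (m : ℝ) * (Real.log ((m : ℝ) + 1) - Real.log m) else 0) +
                Rbig * (Real.log ((m : ℝ) + 1) - Real.log m)) := by
          intro m hm
          have hmN : m ≤ N := (Finset.mem_range.mp hm).le
          have hΔ : 0 ≤ Real.log ((m : ℝ) + 1) - Real.log m := by
            rcases Nat.eq_zero_or_pos m with rfl | hm1
            · simp
            · exact sub_nonneg.mpr (Real.log_le_log (by exact_mod_cast hm1) (by linarith))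
          have hkL : 0 ≤ (k : ℝ) * Real.log x ^ (k - 1) := by positivity
          rw [hc]; simp only
          by_cases hmt : m < t₀
          · rw [if_pos hmt]
            have hRSm : RS m ≤ m * Γ := by
              rcases Nat.eq_zero_or_pos m with rfl | hm1
              · rw [hRS0]; simp
              · exact hsmall m hm1 hmt
            calc k * Real.log x ^ (k - 1) * (Real.log ((m : ℝ) + 1) - Real.log m) * RS m
                ≤ k * Real.log x ^ (k - 1) * (Real.log ((m : ℝ) + 1) - Real.log m) * (m * Γ) :=
                  mul_le_mul_of_nonneg_left hRSm (mul_nonneg hkL hΔ)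
              _ = k * Real.log x ^ (k - 1) *
                    (Γ * ((m : ℝ) * (Real.log ((m : ℝ) + 1) - Real.log m)) + Rbig * 0) := by ring
              _ ≤ k * Real.log x ^ (k - 1) *
                    (Γ * ((m : ℝ) * (Real.log ((m : ℝ) + 1) - Real.log m)) +
                      Rbig * (Real.log ((m : ℝ) + 1) - Real.log m)) := by
                  gcongr
          · push Not at hmt
            rw [if_neg (not_lt.mpr hmt), mul_zero, zero_add]
            calc k * Real.log x ^ (k - 1) * (Real.log ((m : ℝ) + 1) - Real.log m) * RS m
                ≤ k * Real.log x ^ (k - 1) * (Real.log ((m : ℝ) + 1) - Real.log m) * Rbig :=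
                  mul_le_mul_of_nonneg_left (hbig m hmt hmN) (mul_nonneg hkL hΔ)
              _ = k * Real.log x ^ (k - 1) * (Rbig * (Real.log ((m : ℝ) + 1) - Real.log m)) := by
                  ring
        refine (Finset.sum_le_sum hterm).trans ?_
        rw [← Finset.mul_sum, Finset.sum_add_distrib, ← Finset.mul_sum, ← Finset.mul_sum,
          sum_range_log_succ_sub]
        refine mul_le_mul_of_nonneg_left (add_le_add (mul_le_mul_of_nonneg_left ?_ hΓ) le_rfl)
          (by positivity)
        -- `∑_{m < N} [m < t₀] m Δlog(m) ≤ ∑_{m < t₀} m Δlog(m) ≤ t₀`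
        rw [Finset.sum_ite, Finset.sum_const_zero, add_zero]
        have hsub : (Finset.range N).filter (fun m => m < t₀) ⊆ Finset.range t₀ := fun m hm =>
          Finset.mem_range.mpr (Finset.mem_filter.mp hm).2
        refine (Finset.sum_le_sum_of_subset_of_nonneg hsub fun m _ _ => ?_).trans
          (sum_range_mul_log_succ_sub_le t₀)
        rcases Nat.eq_zero_or_pos m with rfl | hm1
        · simp
        · exact mul_nonneg (Nat.cast_nonneg m) (sub_nonneg.mpr
            (Real.log_le_log (by exact_mod_cast hm1) (by linarith)))

/-- **The trivial bound for the squarefree remainder sums at height `t ≤ x`** (used below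
`t < x^{1−ε/2}`, where the level of distribution at `t` does not reach the moduli): for
`1 ≤ t ≤ x` and `Q ≤ x + 1`,
`∑_{q < Q, q squarefree} |R_q(t)| ≤ ∑_{n ≤ t} a_n τ(n) + t ∑_{q ≤ x} |μ(q)| g(q)
  ≤ t (2 √(K_c C_τ (log x)^{C_c} (log x)^8) + 3K log x)`
by Cauchy–Schwarz with `∑_{n≤t} a_n² ≤ K_c t (log t)^{C_c}`, `∑_{n ≤ t} τ(n)² ≤ C_τ t (log t)^8`,
and `sum_rough_abs_moebius_mul_density_le` (with `z = 2`). [folklore] -/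
theorem remainderSum_trivial_le (A : SieveSequence) {K : ℝ} (hK : HasSieveDimension A.density 1 K)
    (hsize : ∀ x, A.size x = x) {x : ℝ} (hx : 2 ≤ x) {Q : ℕ} (hQ : ((Q : ℕ) : ℝ) ≤ x + 1)
    {Kc Cc Cτ : ℝ} (hKc : 0 < Kc) (hCc : 0 ≤ Cc) (hCτ : 0 < Cτ)
    (hcr : ∀ u : ℝ, 2 ≤ u → ∑ n ∈ Ioc 0 ⌊u⌋₊, A.a n ^ 2 ≤ Kc * u * Real.log u ^ Cc)
    (hτ : ∀ u : ℝ, 2 ≤ u →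
      ∑ n ∈ Icc 1 ⌊u⌋₊, (σ 0 n : ℝ) ^ 2 ≤ Cτ * u * Real.log u ^ (2 ^ (2 + 1)))
    {t : ℕ} (ht1 : 1 ≤ t) (htx : (t : ℝ) ≤ x) :
    ∑ q ∈ (Ico 1 Q).filter Squarefree, |A.remainder q (t : ℝ)| ≤
      t * (2 * Real.sqrt (Kc * Cτ * Real.log x ^ Cc * Real.log x ^ (2 ^ (2 + 1))) +
        3 * K * Real.log x) := by
  set S := (Ico 1 Q).filter Squarefree with hS
  set L := Real.log x with hL
  have hx0 : 0 < x := by linarith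
  have hx1 : 1 < x := by linarith
  have hlog2 : 0 < Real.log 2 := Real.log_pos one_lt_two
  have hL2 : Real.log 2 ≤ L := Real.log_le_log two_pos hx
  have hL0 : 0 < L := hlog2.trans_le hL2
  have ht0 : (0 : ℝ) < t := by exact_mod_cast ht1
  have hK1 : 1 ≤ K := hK.one_le
  have hg0 : ∀ p : ℕ, p.Prime → 0 ≤ A.density p := fun p hp => (hK.1 p hp).1
  -- `|R_q(t)| ≤ A_q(t) + |g(q)| t`
  have hRq : ∀ q ∈ S, |A.remainder q (t : ℝ)| ≤
      (∑ n ∈ Ioc 0 t, if q ∣ n then A.a n else 0) + |(μ q : ℝ)| * A.density q * t := by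
    intro q hq
    have hqsf : Squarefree q := (Finset.mem_filter.mp hq).2
    have hgq : 0 ≤ A.density q := by
      rw [BetaSieve.map_eq_prod_primeFactors A.density_mult hqsf]
      exact Finset.prod_nonneg fun p hp => hg0 p (Nat.prime_of_mem_primeFactors hp)
    have hμq : |(μ q : ℝ)| = 1 := by
      rw [ArithmeticFunction.moebius_apply_of_squarefree hqsf]; push_cast
      rw [abs_pow, abs_neg, abs_one, one_pow]
    rw [SieveSequence.remainder, SieveSequence.congrSum, hsize, Nat.floor_natCast,
      Finset.sum_filter, hμq, one_mul]
    have hA0 : 0 ≤ ∑ n ∈ Ioc 0 t, if q ∣ n then A.a n else 0 :=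
      Finset.sum_nonneg fun n _ => by split_ifs; exacts [A.a_nonneg n, le_rfl]
    calc |(∑ n ∈ Ioc 0 t, if q ∣ n then A.a n else 0) - A.density q * t|
        ≤ |∑ n ∈ Ioc 0 t, if q ∣ n then A.a n else 0| + |A.density q * t| := abs_sub _ _
      _ = (∑ n ∈ Ioc 0 t, if q ∣ n then A.a n else 0) + A.density q * t := by
          rw [abs_of_nonneg hA0, abs_of_nonneg (mul_nonneg hgq ht0.le)]
  -- the first part: `∑_q A_q(t) ≤ ∑_n a_n τ(n)`
  have hpart1 : ∑ q ∈ S, (∑ n ∈ Ioc 0 t, if q ∣ n then A.a n else 0) ≤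
      ∑ n ∈ Ioc 0 t, A.a n * (σ 0 n : ℝ) := by
    rw [Finset.sum_comm]
    refine Finset.sum_le_sum fun n hn => ?_
    have hn0 : n ≠ 0 := (Finset.mem_Ioc.mp hn).1.ne'
    rw [Finset.sum_ite, Finset.sum_const_zero, add_zero, Finset.sum_const, nsmul_eq_mul, mul_comm]
    refine mul_le_mul_of_nonneg_left ?_ (A.a_nonneg n)
    rw [ArithmeticFunction.sigma_zero_apply]
    exact_mod_cast Finset.card_le_card (fun q hq => Nat.mem_divisors.mpr
      ⟨(Finset.mem_filter.mp hq).2, hn0⟩)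
  -- the two second-moment bounds at height `t`
  have hsq1 : ∑ n ∈ Ioc 0 t, A.a n ^ 2 ≤ 2 * Kc * t * L ^ Cc := by
    rcases lt_or_ge t 2 with ht2 | ht2
    · have ht1' : t = 1 := by omega
      subst ht1'
      have hsub : Ioc 0 1 ⊆ Ioc 0 ⌊(2 : ℝ)⌋₊ := by
        intro n hn; rw [Finset.mem_Ioc] at hn ⊢
        have : ⌊(2 : ℝ)⌋₊ = 2 := by norm_num
        rw [this]; omega
      calc ∑ n ∈ Ioc 0 1, A.a n ^ 2 ≤ ∑ n ∈ Ioc 0 ⌊(2 : ℝ)⌋₊, A.a n ^ 2 :=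
            Finset.sum_le_sum_of_subset_of_nonneg hsub fun n _ _ => sq_nonneg _
        _ ≤ Kc * 2 * Real.log 2 ^ Cc := hcr 2 le_rfl
        _ ≤ Kc * 2 * L ^ Cc := by gcongr
        _ = 2 * Kc * ((1 : ℕ) : ℝ) * L ^ Cc := by push_cast; ring
    · have ht2' : (2 : ℝ) ≤ t := by exact_mod_cast ht2
      have h := hcr t ht2'
      rw [Nat.floor_natCast] at h
      have hlogt : Real.log t ≤ L := Real.log_le_log (by linarith) htx
      have hlogt0 : 0 ≤ Real.log t := Real.log_nonneg (by linarith)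
      calc ∑ n ∈ Ioc 0 t, A.a n ^ 2 ≤ Kc * t * Real.log t ^ Cc := h
        _ ≤ Kc * t * L ^ Cc := by gcongr
        _ ≤ 2 * Kc * t * L ^ Cc := by
            have : 0 ≤ Kc * t * L ^ Cc := by positivity
            linarith
  have hsq2 : ∑ n ∈ Ioc 0 t, (σ 0 n : ℝ) ^ 2 ≤ 2 * Cτ * t * L ^ (2 ^ (2 + 1)) := by
    have hIoc : Ioc 0 t = Icc 1 t := rfl
    rcases lt_or_ge t 2 with ht2 | ht2
    · have ht1' : t = 1 := by omega
      subst ht1'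
      have hsub : Ioc 0 1 ⊆ Icc 1 ⌊(2 : ℝ)⌋₊ := by
        intro n hn; rw [Finset.mem_Ioc] at hn; rw [Finset.mem_Icc]
        have : ⌊(2 : ℝ)⌋₊ = 2 := by norm_num
        rw [this]; omega
      calc ∑ n ∈ Ioc 0 1, (σ 0 n : ℝ) ^ 2 ≤ ∑ n ∈ Icc 1 ⌊(2 : ℝ)⌋₊, (σ 0 n : ℝ) ^ 2 :=
            Finset.sum_le_sum_of_subset_of_nonneg hsub fun n _ _ => sq_nonneg _
        _ ≤ Cτ * 2 * Real.log 2 ^ (2 ^ (2 + 1)) := hτ 2 le_rfl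
        _ ≤ Cτ * 2 * L ^ (2 ^ (2 + 1)) := by gcongr
        _ = 2 * Cτ * ((1 : ℕ) : ℝ) * L ^ (2 ^ (2 + 1)) := by push_cast; ring
    · have ht2' : (2 : ℝ) ≤ t := by exact_mod_cast ht2
      have h := hτ t ht2'
      rw [Nat.floor_natCast, ← hIoc] at h
      have hlogt : Real.log t ≤ L := Real.log_le_log (by linarith) htx
      have hlogt0 : 0 ≤ Real.log t := Real.log_nonneg (by linarith)
      calc ∑ n ∈ Ioc 0 t, (σ 0 n : ℝ) ^ 2 ≤ Cτ * t * Real.log t ^ (2 ^ (2 + 1)) := h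
        _ ≤ Cτ * t * L ^ (2 ^ (2 + 1)) := by gcongr
        _ ≤ 2 * Cτ * t * L ^ (2 ^ (2 + 1)) := by
            have : 0 ≤ Cτ * t * L ^ (2 ^ (2 + 1)) := by positivity
            linarith
  have hCS : ∑ n ∈ Ioc 0 t, A.a n * (σ 0 n : ℝ) ≤
      2 * t * Real.sqrt (Kc * Cτ * L ^ Cc * L ^ (2 ^ (2 + 1))) := by
    refine (sum_mul_le_sqrt_mul A.a (fun n => (σ 0 n : ℝ)) t).trans ?_
    have hprod : (∑ n ∈ Ioc 0 t, A.a n ^ 2) * ∑ n ∈ Ioc 0 t, (σ 0 n : ℝ) ^ 2 ≤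
        (2 * t) ^ 2 * (Kc * Cτ * L ^ Cc * L ^ (2 ^ (2 + 1))) := by
      calc (∑ n ∈ Ioc 0 t, A.a n ^ 2) * ∑ n ∈ Ioc 0 t, (σ 0 n : ℝ) ^ 2
          ≤ (2 * Kc * t * L ^ Cc) * (2 * Cτ * t * L ^ (2 ^ (2 + 1))) :=
            mul_le_mul hsq1 hsq2 (Finset.sum_nonneg fun n _ => sq_nonneg _) (by positivity)
        _ = (2 * t) ^ 2 * (Kc * Cτ * L ^ Cc * L ^ (2 ^ (2 + 1))) := by ring
    calc Real.sqrt ((∑ n ∈ Ioc 0 t, A.a n ^ 2) * ∑ n ∈ Ioc 0 t, (σ 0 n : ℝ) ^ 2)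
        ≤ Real.sqrt ((2 * t) ^ 2 * (Kc * Cτ * L ^ Cc * L ^ (2 ^ (2 + 1)))) :=
          Real.sqrt_le_sqrt hprod
      _ = 2 * t * Real.sqrt (Kc * Cτ * L ^ Cc * L ^ (2 ^ (2 + 1))) := by
          rw [Real.sqrt_mul (sq_nonneg _), Real.sqrt_sq (by positivity)]
  -- the second part: `∑_q |μ(q)| g(q) ≤ 2K log x / log 2 ≤ 3K L`
  have hpart2 : ∑ q ∈ S, |(μ q : ℝ)| * A.density q ≤ 3 * K * L := by
    have hsub : S ⊆ (Ioc 0 ⌊x⌋₊).filter (fun d : ℕ => d.Coprime (primesProdBelow 2)) := by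
      intro q hq
      obtain ⟨hq, -⟩ := Finset.mem_filter.mp hq
      obtain ⟨hq1, hqQ⟩ := Finset.mem_Ico.mp hq
      rw [Finset.mem_filter, Finset.mem_Ioc, SieveSequence.primesProdBelow_two]
      refine ⟨⟨hq1, Nat.le_floor ?_⟩, Nat.coprime_one_right q⟩
      have : ((q + 1 : ℕ) : ℝ) ≤ Q := by exact_mod_cast hqQ
      push_cast at this; linarith
    have hnn : ∀ q ∈ (Ioc 0 ⌊x⌋₊).filter (fun d : ℕ => d.Coprime (primesProdBelow 2)),
        0 ≤ |(μ q : ℝ)| * A.density q := by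
      intro q _
      by_cases hqsf : Squarefree q
      · refine mul_nonneg (abs_nonneg _) ?_
        rw [BetaSieve.map_eq_prod_primeFactors A.density_mult hqsf]
        exact Finset.prod_nonneg fun p hp => hg0 p (Nat.prime_of_mem_primeFactors hp)
      · rw [ArithmeticFunction.moebius_eq_zero_of_not_squarefree hqsf]; simp
    refine (Finset.sum_le_sum_of_subset_of_nonneg hsub fun q hq _ => hnn q hq).trans ?_
    refine (sum_rough_abs_moebius_mul_density_le A hK le_rfl hx).trans ?_
    rw [div_le_iff₀ hlog2]
    have h23 : (2 : ℝ) / 3 ≤ Real.log 2 := by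
      have := Real.log_two_gt_d9; norm_num at this ⊢; linarith
    have hKL : 0 ≤ K * L := by positivity
    calc 2 * K * Real.log x = 3 * (K * L) * (2 / 3) := by rw [hL]; ring
      _ ≤ 3 * (K * L) * Real.log 2 := mul_le_mul_of_nonneg_left h23 (by positivity)
      _ = 3 * K * L * Real.log 2 := by ring
  -- assembling
  calc ∑ q ∈ S, |A.remainder q (t : ℝ)|
      ≤ ∑ q ∈ S, ((∑ n ∈ Ioc 0 t, if q ∣ n then A.a n else 0) +
          |(μ q : ℝ)| * A.density q * t) := Finset.sum_le_sum hRq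
    _ = ∑ q ∈ S, (∑ n ∈ Ioc 0 t, if q ∣ n then A.a n else 0) +
          t * ∑ q ∈ S, |(μ q : ℝ)| * A.density q := by
        rw [Finset.sum_add_distrib, Finset.mul_sum]
        congr 1
        exact Finset.sum_congr rfl fun q _ => by ring
    _ ≤ 2 * t * Real.sqrt (Kc * Cτ * L ^ Cc * L ^ (2 ^ (2 + 1))) + t * (3 * K * L) :=
        add_le_add (hpart1.trans hCS) (mul_le_mul_of_nonneg_left hpart2 ht0.le)
    _ = t * (2 * Real.sqrt (Kc * Cτ * L ^ Cc * L ^ (2 ^ (2 + 1))) + 3 * K * L) := by ring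

/-! ### `Σ₁` against the model main term -/

/-- **The sieve step of Lemma 12 for `X(x) = x`, summed over `d`**: with
`Φ_d = ∑_{n ≤ x} φ_d(n)`, `V = V(z)`, `D = {1 ≤ d < ⌈y⌉ : (d, P(z)) = 1}` and level `D₀ ≥ z ≥ 2`,
`|Σ₁ − V ∑_{d ∈ D} μ(d) g(d) Φ_d| ≤ C_F e^{−log D₀/log z} V x (log x)^k ∑_{d ∈ D} |μ(d)| g(d) + RR`,
`RR` the total weighted remainder of `weightedRemainders_le` (fundamental lemma
`SieveSequence.fundamental_lemma_explicit` for each squarefree `d`, via `weighted_sifted_sub_le'`;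
`Φ_d ≤ x (log x)^k`). [cite: FriedlanderIwaniecPisa1978, Lemma 12 (proof, p. 739)] -/
theorem abs_sigma1_sub_model_le (A : SieveSequence) {K : ℝ} (hK : HasSieveDimension A.density 1 K)
    (k : ℕ) {x y z D₀ : ℝ} (hx : 1 ≤ x) (hz : 2 ≤ z) (hzD : z ≤ D₀) :
    |sigma1 A k x y z - A.densityProduct (primesProdBelow z) *
        ∑ d ∈ (Ico 1 ⌈y⌉₊).filter (fun d : ℕ => d.Coprime (primesProdBelow z)),
          (μ d : ℝ) * A.density d * ∑ n ∈ Ioc 0 ⌊x⌋₊, max 0 (Real.log ((n : ℝ) / d)) ^ k| ≤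
      SieveSequence.flConst 1 K * Real.exp (-(Real.log D₀ / Real.log z)) *
          A.densityProduct (primesProdBelow z) * (x * Real.log x ^ k) *
          ∑ d ∈ (Ico 1 ⌈y⌉₊).filter (fun d : ℕ => d.Coprime (primesProdBelow z)),
            |(μ d : ℝ)| * A.density d +
        ∑ d ∈ ((Ico 1 ⌈y⌉₊).filter (fun d : ℕ => d.Coprime (primesProdBelow z))).filter
            Squarefree,
          ∑ ν ∈ (primesProdBelow z).divisors.filter (fun ν : ℕ => (ν : ℝ) ≤ D₀),
            |(∑ n ∈ (Ioc 0 ⌊x⌋₊).filter (fun n : ℕ => d * ν ∣ n),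
                A.a n * max 0 (Real.log ((n : ℝ) / d)) ^ k) -
              A.density (d * ν) * ∑ n ∈ Ioc 0 ⌊x⌋₊, max 0 (Real.log ((n : ℝ) / d)) ^ k| := by
  set P := primesProdBelow z with hP
  set V := A.densityProduct P with hV
  set D := (Ico 1 ⌈y⌉₊).filter (fun d : ℕ => d.Coprime P) with hD
  set CF := SieveSequence.flConst 1 K with hCF
  set E := Real.exp (-(Real.log D₀ / Real.log z)) with hE
  set Φ : ℕ → ℝ := fun d => ∑ n ∈ Ioc 0 ⌊x⌋₊, max 0 (Real.log ((n : ℝ) / d)) ^ k with hΦ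
  set RR : ℕ → ℝ := fun d => ∑ ν ∈ P.divisors.filter (fun ν : ℕ => (ν : ℝ) ≤ D₀),
    |(∑ n ∈ (Ioc 0 ⌊x⌋₊).filter (fun n : ℕ => d * ν ∣ n),
        A.a n * max 0 (Real.log ((n : ℝ) / d)) ^ k) - A.density (d * ν) * Φ d| with hRR
  have hK1 : 1 ≤ K := hK.one_le
  have hCF0 : 0 < CF := SieveSequence.flConst_pos zero_le_one (by linarith)
  have hx0 : 0 < x := by linarith
  have hL0 : 0 ≤ Real.log x := Real.log_nonneg hx
  have hg0 : ∀ p : ℕ, p.Prime → 0 ≤ A.density p := fun p hp => (hK.1 p hp).1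
  have hV0 : 0 ≤ V := by
    rw [hV, hP, densityProduct_primesProdBelow]
    exact Finset.prod_nonneg fun p hp =>
      (sub_pos.mpr (hK.1 p (Nat.prime_of_mem_primesBelow hp)).2).le
  have hFL' : ∀ A : SieveSequence, HasSieveDimension A.density 1 K → ∀ x z D : ℝ, 2 ≤ z → z ≤ D →
      0 ≤ A.size x →
        |A.sifted x (primesProdBelow z) - A.size x * A.densityProduct (primesProdBelow z)| ≤
          CF * A.size x * A.densityProduct (primesProdBelow z) *
              Real.exp (-(Real.log D / Real.log z)) +
            ∑ d ∈ (primesProdBelow z).divisors.filter (fun d : ℕ => (d : ℝ) ≤ D),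
              |A.remainder d x| :=
    fun A' hK' x' z' D' hz' hzD' hsz' =>
      SieveSequence.fundamental_lemma_explicit hK' one_pos hz' hzD' hsz'
  -- `Σ₁ = ∑_d μ(d) S_d`
  rw [sigma1_eq_sum_moebius_mul, ← hP, ← hD, Finset.mul_sum, ← Finset.sum_sub_distrib]
  -- termwise
  have hterm : ∀ d ∈ D,
      |(μ d : ℝ) * (∑ n ∈ (Ioc 0 ⌊x⌋₊).filter (fun n : ℕ => n.Coprime P ∧ d ∣ n),
          A.a n * max 0 (Real.log ((n : ℝ) / d)) ^ k) - V * ((μ d : ℝ) * A.density d * Φ d)| ≤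
        CF * E * V * (x * Real.log x ^ k) * (|(μ d : ℝ)| * A.density d) +
          if Squarefree d then RR d else 0 := by
    intro d hd
    obtain ⟨hd', hdP⟩ := Finset.mem_filter.mp hd
    have hd1 : 1 ≤ d := (Finset.mem_Ico.mp hd').1
    by_cases hdsf : Squarefree d
    · rw [if_pos hdsf]
      have hgd : 0 ≤ A.density d := by
        rw [BetaSieve.map_eq_prod_primeFactors A.density_mult hdsf]
        exact Finset.prod_nonneg fun p hp => hg0 p (Nat.prime_of_mem_primeFactors hp)
      have hμd : |(μ d : ℝ)| = 1 := by
        rw [ArithmeticFunction.moebius_apply_of_squarefree hdsf]; push_cast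
        rw [abs_pow, abs_neg, abs_one, one_pow]
      obtain ⟨hw0, -, -⟩ := logWeight_props k hd1
        (w := fun n => max 0 (Real.log ((n : ℝ) / d)) ^ k) (fun n => rfl)
      obtain ⟨hΦ0, hΦle⟩ := sum_logWeight_le (k := k) (d := d) hx hd1
      have h := weighted_sifted_sub_le' hFL' A hK hw0 hgd hdP x D₀ hΦ0 hz hzD
      rw [← hP] at h
      -- `h : |S_d − g(d) Φ_d V| ≤ CF (g d Φ_d) V E + RR d`
      have hRRd : ∑ ν ∈ P.divisors.filter (fun ν : ℕ => (ν : ℝ) ≤ D₀),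
          |(∑ n ∈ (Ioc 0 ⌊x⌋₊).filter (fun n : ℕ => d * ν ∣ n),
              A.a n * max 0 (Real.log ((n : ℝ) / d)) ^ k) -
            A.density (d * ν) * ∑ n ∈ Ioc 0 ⌊x⌋₊, max 0 (Real.log ((n : ℝ) / d)) ^ k| = RR d := rfl
      rw [hRRd] at h
      have heq : (μ d : ℝ) * (∑ n ∈ (Ioc 0 ⌊x⌋₊).filter (fun n : ℕ => n.Coprime P ∧ d ∣ n),
          A.a n * max 0 (Real.log ((n : ℝ) / d)) ^ k) - V * ((μ d : ℝ) * A.density d * Φ d) =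
          (μ d : ℝ) * ((∑ n ∈ (Ioc 0 ⌊x⌋₊).filter (fun n : ℕ => n.Coprime P ∧ d ∣ n),
            A.a n * max 0 (Real.log ((n : ℝ) / d)) ^ k) - A.density d * Φ d * V) := by ring
      rw [heq, abs_mul, hμd, one_mul, one_mul]
      refine h.trans (add_le_add ?_ le_rfl)
      have : CF * (A.density d * Φ d) * V * E = CF * E * V * Φ d * A.density d := by ring
      rw [this]
      have h1 : CF * E * V * Φ d ≤ CF * E * V * (x * Real.log x ^ k) :=
        mul_le_mul_of_nonneg_left hΦle (by positivity)
      exact mul_le_mul_of_nonneg_right h1 hgd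
    · rw [if_neg hdsf, ArithmeticFunction.moebius_eq_zero_of_not_squarefree hdsf]
      simp
  refine (Finset.abs_sum_le_sum_abs _ _).trans ((Finset.sum_le_sum hterm).trans (le_of_eq ?_))
  rw [Finset.sum_add_distrib, ← Finset.mul_sum, Finset.sum_ite, Finset.sum_const_zero, add_zero]

/-- **The model sum against `x V ∑ μ(d) g(d) (log x/d)^k`**: with the notation of
`abs_sigma1_sub_model_le`, for `x ≥ 2`, `y ≤ x`, `k ≥ 1`,
`|V ∑_{d ∈ D} μ(d) g(d) Φ_d − x V ∑_{d ∈ D} μ(d) g(d) (log x/d)^k| ≤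
 V (2k+1) x (log x)^{k−1} ∑_{d ∈ D} |μ(d)| g(d)` (`abs_sum_logWeight_sub_le`).
[cite: FriedlanderIwaniecPisa1978, Lemma 12 (proof, p. 739)] -/
theorem abs_model_sub_le (A : SieveSequence) {K : ℝ} (hK : HasSieveDimension A.density 1 K)
    {k : ℕ} (hk : 1 ≤ k) {x y z : ℝ} (hx : 2 ≤ x) (hyx : y ≤ x) :
    |A.densityProduct (primesProdBelow z) *
        ∑ d ∈ (Ico 1 ⌈y⌉₊).filter (fun d : ℕ => d.Coprime (primesProdBelow z)),
          (μ d : ℝ) * A.density d * ∑ n ∈ Ioc 0 ⌊x⌋₊, max 0 (Real.log ((n : ℝ) / d)) ^ k -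
      x * A.densityProduct (primesProdBelow z) *
        ∑ d ∈ (Ico 1 ⌈y⌉₊).filter (fun d : ℕ => d.Coprime (primesProdBelow z)),
          (μ d : ℝ) * A.density d * Real.log (x / d) ^ k| ≤
      A.densityProduct (primesProdBelow z) * ((2 * k + 1) * x * Real.log x ^ (k - 1)) *
        ∑ d ∈ (Ico 1 ⌈y⌉₊).filter (fun d : ℕ => d.Coprime (primesProdBelow z)),
          |(μ d : ℝ)| * A.density d := by
  set P := primesProdBelow z with hP
  set V := A.densityProduct P with hV
  set D := (Ico 1 ⌈y⌉₊).filter (fun d : ℕ => d.Coprime P) with hD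
  have hx0 : 0 < x := by linarith
  have hg0 : ∀ p : ℕ, p.Prime → 0 ≤ A.density p := fun p hp => (hK.1 p hp).1
  have hV0 : 0 ≤ V := by
    rw [hV, hP, densityProduct_primesProdBelow]
    exact Finset.prod_nonneg fun p hp =>
      (sub_pos.mpr (hK.1 p (Nat.prime_of_mem_primesBelow hp)).2).le
  have heq : V * ∑ d ∈ D, (μ d : ℝ) * A.density d *
        ∑ n ∈ Ioc 0 ⌊x⌋₊, max 0 (Real.log ((n : ℝ) / d)) ^ k -
      x * V * ∑ d ∈ D, (μ d : ℝ) * A.density d * Real.log (x / d) ^ k =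
      V * ∑ d ∈ D, (μ d : ℝ) * A.density d *
        ((∑ n ∈ Ioc 0 ⌊x⌋₊, max 0 (Real.log ((n : ℝ) / d)) ^ k) - x * Real.log (x / d) ^ k) := by
    rw [mul_comm x V, mul_assoc, Finset.mul_sum D (fun d => _) x, ← mul_sub,
      ← Finset.sum_sub_distrib]
    congr 1
    refine Finset.sum_congr rfl fun d _ => by ring
  rw [heq, abs_mul, abs_of_nonneg hV0, mul_assoc]
  refine mul_le_mul_of_nonneg_left ?_ hV0
  rw [Finset.mul_sum]
  refine (Finset.abs_sum_le_sum_abs _ _).trans (Finset.sum_le_sum fun d hd => ?_)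
  obtain ⟨hd', hdP⟩ := Finset.mem_filter.mp hd
  have hd1 : 1 ≤ d := (Finset.mem_Ico.mp hd').1
  have hdx : (d : ℝ) ≤ x := by
    have h1 : d + 1 ≤ ⌈y⌉₊ := (Finset.mem_Ico.mp hd').2
    have h2 : ((d + 1 : ℕ) : ℝ) ≤ ⌈y⌉₊ := by exact_mod_cast h1
    have h3 : (⌈y⌉₊ : ℝ) < y + 1 := Nat.ceil_lt_add_one (by
      by_contra hy; push Not at hy
      have : ⌈y⌉₊ = 0 := Nat.ceil_eq_zero.mpr hy.le
      omega)
    push_cast at h2; linarith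
  by_cases hdsf : Squarefree d
  · have hgd : 0 ≤ A.density d := by
      rw [BetaSieve.map_eq_prod_primeFactors A.density_mult hdsf]
      exact Finset.prod_nonneg fun p hp => hg0 p (Nat.prime_of_mem_primeFactors hp)
    rw [abs_mul, abs_mul, abs_of_nonneg hgd]
    calc |(μ d : ℝ)| * A.density d *
          |(∑ n ∈ Ioc 0 ⌊x⌋₊, max 0 (Real.log ((n : ℝ) / d)) ^ k) - x * Real.log (x / d) ^ k|
        ≤ |(μ d : ℝ)| * A.density d * ((2 * k + 1) * x * Real.log x ^ (k - 1)) :=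
          mul_le_mul_of_nonneg_left (abs_sum_logWeight_sub_le hk hx hd1 hdx)
            (mul_nonneg (abs_nonneg _) hgd)
      _ = (2 * k + 1) * x * Real.log x ^ (k - 1) * (|(μ d : ℝ)| * A.density d) := by ring
  · simp [ArithmeticFunction.moebius_eq_zero_of_not_squarefree hdsf]

/-- **Replacing `V(z)` by `H P(z)`**: `|x V Σ_r − H x F| ≤ x |V − H P(z)| (log x)^k ∑_{d ∈ D} |μ(d)|/d`,
where `Σ_r = ∑_{d ∈ D} μ(d) d⁻¹ (log x/d)^k` and `F = P(z) Σ_r` is `mainTermF`.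
[cite: FriedlanderIwaniecPisa1978, Lemma 12 (proof, p. 739)] -/
theorem abs_main_sub_mainTermF_le (A : SieveSequence) (H : ℝ) (k : ℕ) {x y z : ℝ} (hx : 1 ≤ x)
    (hyx : y ≤ x) :
    |x * A.densityProduct (primesProdBelow z) *
        ∑ d ∈ (Ico 1 ⌈y⌉₊).filter (fun d : ℕ => d.Coprime (primesProdBelow z)),
          (μ d : ℝ) * (d : ℝ)⁻¹ * Real.log (x / d) ^ k - H * x * mainTermF k x y z| ≤
      x * |A.densityProduct (primesProdBelow z) -
          H * ∏ p ∈ Nat.primesBelow ⌈z⌉₊, (1 - (p : ℝ)⁻¹)| * Real.log x ^ k *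
        ∑ d ∈ (Ico 1 ⌈y⌉₊).filter (fun d : ℕ => d.Coprime (primesProdBelow z)),
          |(μ d : ℝ)| * (d : ℝ)⁻¹ := by
  set D := (Ico 1 ⌈y⌉₊).filter (fun d : ℕ => d.Coprime (primesProdBelow z)) with hD
  set V := A.densityProduct (primesProdBelow z) with hV
  set Pz := ∏ p ∈ Nat.primesBelow ⌈z⌉₊, (1 - (p : ℝ)⁻¹) with hPz
  set Sr := ∑ d ∈ D, (μ d : ℝ) * (d : ℝ)⁻¹ * Real.log (x / d) ^ k with hSr
  have hx0 : 0 < x := by linarith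
  have hL0 : 0 ≤ Real.log x := Real.log_nonneg hx
  have hF : mainTermF k x y z = Pz * Sr := by
    rw [mainTermF, ← hD, ← hPz, hSr]
    congr 1
  rw [hF]
  have heq : x * V * Sr - H * x * (Pz * Sr) = x * ((V - H * Pz) * Sr) := by ring
  rw [heq, abs_mul, abs_of_pos hx0, abs_mul, mul_assoc, mul_assoc]
  refine mul_le_mul_of_nonneg_left (mul_le_mul_of_nonneg_left ?_ (abs_nonneg _)) hx0.le
  rw [hSr, Finset.mul_sum]
  refine (Finset.abs_sum_le_sum_abs _ _).trans (Finset.sum_le_sum fun d hd => ?_)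
  obtain ⟨hd', -⟩ := Finset.mem_filter.mp hd
  have hd1 : 1 ≤ d := (Finset.mem_Ico.mp hd').1
  have hd0 : (0 : ℝ) < d := by exact_mod_cast hd1
  have hdx : (d : ℝ) ≤ x := by
    have h1 : d + 1 ≤ ⌈y⌉₊ := (Finset.mem_Ico.mp hd').2
    have h2 : ((d + 1 : ℕ) : ℝ) ≤ ⌈y⌉₊ := by exact_mod_cast h1
    have h3 : (⌈y⌉₊ : ℝ) < y + 1 := Nat.ceil_lt_add_one (by
      by_contra hy; push Not at hy
      have : ⌈y⌉₊ = 0 := Nat.ceil_eq_zero.mpr hy.le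
      omega)
    push_cast at h2; linarith
  have hlog0 : 0 ≤ Real.log (x / d) := Real.log_nonneg ((one_le_div hd0).mpr hdx)
  have hlogle : Real.log (x / d) ≤ Real.log x := by
    rw [Real.log_div hx0.ne' hd0.ne']; linarith [Real.log_nonneg (show (1:ℝ) ≤ d by exact_mod_cast hd1)]
  rw [abs_mul, abs_mul, abs_of_nonneg (inv_nonneg.mpr hd0.le), abs_pow, abs_of_nonneg hlog0]
  calc |(μ d : ℝ)| * (d : ℝ)⁻¹ * Real.log (x / d) ^ k ≤ |(μ d : ℝ)| * (d : ℝ)⁻¹ * Real.log x ^ k :=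
        mul_le_mul_of_nonneg_left (pow_le_pow_left₀ hlog0 hlogle k)
          (mul_nonneg (abs_nonneg _) (inv_nonneg.mpr hd0.le))
    _ = Real.log x ^ k * (|(μ d : ℝ)| * (d : ℝ)⁻¹) := by ring

/-! ### Lemma 12 at a fixed height: all error terms explicit -/

/-- **[FriedlanderIwaniecPisa1978] Lemma 12 for `X(x) = x`, pointwise form with explicit error
terms.** For `k ≥ 2`, `2 ≤ z ≤ x`, `y ≤ x`, `s ≥ 1` with `V(z) ≤ C_V/log z`,
`|V(z) − H P(z)| ≤ δ''/log z`, the oscillation hypothesis of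
`abs_sum_moebius_mul_density_sub_inv_le` at `z` with `η`, and the squarefree remainder sums
`RS(t)` (moduli `< ⌈L'⌉`, where `d z^s < L'` for all rough `d < ⌈y⌉`) bounded by `t Γ` below `t₀`
and by `R_big` on `[t₀, ⌊x⌋]`:
`|Σ₁ − H x F| ≤ 2K C_F C_V e^{−s} x L^{k−1} (L/log z)² + (L^k R_big + k L^{k−1}(Γ t₀ + R_big log ⌊x⌋))
  + 2K C_V (2k+1) x L^{k−2} (L/log z)² + 2K e⁵ C_V η x L^{k−2} (L/log z)⁴ + e⁵ δ'' x L^{k−1} (L/log z)²`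
(`L = log x`). Ingredients: `abs_sigma1_sub_model_le`, `weightedRemainders_le`, `abs_model_sub_le`,
`abs_sum_moebius_mul_density_sub_inv_le` (the oscillatory replacement of Lemma 9),
`abs_main_sub_mainTermF_le`, and the rough sums `∑ |μ(d)| g(d) ≤ 2K L/log z`,
`∑ |μ(d)|/d ≤ e⁵ L/log z`. [cite: FriedlanderIwaniecPisa1978, Lemma 12] -/
theorem sigma1_bound_at (A : SieveSequence) {K : ℝ} (hK : HasSieveDimension A.density 1 K)
    (hsize : ∀ x, A.size x = x) (H : ℝ) {k : ℕ} (hk : 2 ≤ k)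
    {x y z s CV δ'' η L' Γ Rbig : ℝ} {t₀ : ℕ} (hx : 2 ≤ x) (hz : 2 ≤ z) (hzx : z ≤ x)
    (hyx : y ≤ x) (hs : 1 ≤ s) (hCV : 0 ≤ CV) (hη : 0 ≤ η) (hδ'' : 0 ≤ δ'') (hΓ : 0 ≤ Γ)
    (hVz : A.densityProduct (primesProdBelow z) ≤ CV / Real.log z)
    (hVH : |A.densityProduct (primesProdBelow z) -
        H * ∏ p ∈ Nat.primesBelow ⌈z⌉₊, (1 - (p : ℝ)⁻¹)| ≤ δ'' / Real.log z)
    (hosc : ∀ I : Finset ℕ, (∀ p ∈ I, p.Prime ∧ z ≤ (p : ℝ)) →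
      (∀ p₁ ∈ I, ∀ p₃ ∈ I, ∀ p₂ : ℕ, p₂.Prime → p₁ ≤ p₂ → p₂ ≤ p₃ → p₂ ∈ I) →
        |∑ p ∈ I, (A.density p - (p : ℝ)⁻¹) * Real.log p| ≤ η)
    (hL' : ∀ d ∈ (Ico 1 ⌈y⌉₊).filter (fun d : ℕ => d.Coprime (primesProdBelow z)),
      (d : ℝ) * z ^ s < L')
    (hsmall : ∀ t : ℕ, 1 ≤ t → t < t₀ →
      ∑ q ∈ (Ico 1 ⌈L'⌉₊).filter Squarefree, |A.remainder q (t : ℝ)| ≤ t * Γ)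
    (hbig : ∀ t : ℕ, t₀ ≤ t → t ≤ ⌊x⌋₊ →
      ∑ q ∈ (Ico 1 ⌈L'⌉₊).filter Squarefree, |A.remainder q (t : ℝ)| ≤ Rbig)
    (ht₀N : t₀ ≤ ⌊x⌋₊) :
    |sigma1 A k x y z - H * x * mainTermF k x y z| ≤
      2 * K * SieveSequence.flConst 1 K * CV * Real.exp (-s) * x * Real.log x ^ (k - 1) *
          (Real.log x / Real.log z) ^ 2 +
        (Real.log x ^ k * Rbig + k * Real.log x ^ (k - 1) * (Γ * t₀ + Rbig * Real.log ⌊x⌋₊)) +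
        2 * K * CV * (2 * k + 1) * x * Real.log x ^ (k - 2) * (Real.log x / Real.log z) ^ 2 +
        2 * K * Real.exp 5 * CV * η * x * Real.log x ^ (k - 2) * (Real.log x / Real.log z) ^ 4 +
        Real.exp 5 * δ'' * x * Real.log x ^ (k - 1) * (Real.log x / Real.log z) ^ 2 := by
  obtain ⟨m, rfl⟩ : ∃ m, k = m + 2 := ⟨k - 2, by omega⟩
  have e1 : m + 2 - 1 = m + 1 := by omega
  have e2 : m + 2 - 2 = m := by omega
  simp only [e1, e2]
  -- notation
  set P := primesProdBelow z with hP
  set V := A.densityProduct P with hV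
  set D := (Ico 1 ⌈y⌉₊).filter (fun d : ℕ => d.Coprime P) with hD
  set L := Real.log x with hL
  set CF := SieveSequence.flConst 1 K with hCF
  set Pz := ∏ p ∈ Nat.primesBelow ⌈z⌉₊, (1 - (p : ℝ)⁻¹) with hPz
  set Φ : ℕ → ℝ := fun d => ∑ n ∈ Ioc 0 ⌊x⌋₊, max 0 (Real.log ((n : ℝ) / d)) ^ (m + 2) with hΦ
  set M := ∑ d ∈ D, (μ d : ℝ) * A.density d * Φ d with hM
  set Mg := ∑ d ∈ D, (μ d : ℝ) * A.density d * Real.log (x / d) ^ (m + 2) with hMg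
  set Δ := ∑ d ∈ D, (μ d : ℝ) * (A.density d - (d : ℝ)⁻¹) * Real.log (x / d) ^ (m + 2) with hΔ
  set Sr := ∑ d ∈ D, (μ d : ℝ) * (d : ℝ)⁻¹ * Real.log (x / d) ^ (m + 2) with hSr
  set SG := ∑ d ∈ D, |(μ d : ℝ)| * A.density d with hSG
  set SI := ∑ d ∈ D, |(μ d : ℝ)| * (d : ℝ)⁻¹ with hSI
  -- basic facts
  have hK1 : 1 ≤ K := hK.one_le
  have hCF0 : 0 < CF := SieveSequence.flConst_pos zero_le_one (by linarith)
  have hx0 : 0 < x := by linarith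
  have hx1 : 1 ≤ x := by linarith
  have hz0 : 0 < z := by linarith
  have hz1 : 1 < z := by linarith
  have hlogz : 0 < Real.log z := Real.log_pos hz1
  have hL0 : 0 < L := Real.log_pos (by linarith)
  have hg0 : ∀ p : ℕ, p.Prime → 0 ≤ A.density p := fun p hp => (hK.1 p hp).1
  have hV0 : 0 ≤ V := by
    rw [hV, hP, densityProduct_primesProdBelow]
    exact Finset.prod_nonneg fun p hp =>
      (sub_pos.mpr (hK.1 p (Nat.prime_of_mem_primesBelow hp)).2).le
  have hzs : z ≤ z ^ s := by
    conv_lhs => rw [← Real.rpow_one z]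
    exact Real.rpow_le_rpow_of_exponent_le hz1.le hs
  -- the rough sums
  have hμg0 : ∀ d : ℕ, 0 ≤ |(μ d : ℝ)| * A.density d := by
    intro d
    by_cases hdsf : Squarefree d
    · refine mul_nonneg (abs_nonneg _) ?_
      rw [BetaSieve.map_eq_prod_primeFactors A.density_mult hdsf]
      exact Finset.prod_nonneg fun p hp => hg0 p (Nat.prime_of_mem_primeFactors hp)
    · simp [ArithmeticFunction.moebius_eq_zero_of_not_squarefree hdsf]
  have hSGle : SG ≤ 2 * K * L / Real.log z :=
    le_trans (Finset.sum_le_sum_of_subset_of_nonneg (Ico_ceil_filter_subset hyx)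
      fun d _ _ => hμg0 d) (sum_rough_abs_moebius_mul_density_le A hK hz hzx)
  have hSIle : SI ≤ Real.exp 5 * L / Real.log z :=
    le_trans (Finset.sum_le_sum_of_subset_of_nonneg (Ico_ceil_filter_subset hyx)
      fun d _ _ => mul_nonneg (abs_nonneg _) (inv_nonneg.mpr (Nat.cast_nonneg _)))
      (sum_rough_abs_moebius_div_le hz hzx)
  have hSG0 : 0 ≤ SG := Finset.sum_nonneg fun d _ => hμg0 d
  have hSI0 : 0 ≤ SI :=
    Finset.sum_nonneg fun d _ => mul_nonneg (abs_nonneg _) (inv_nonneg.mpr (Nat.cast_nonneg _))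
  have hVSG : V * SG ≤ (CV / Real.log z) * (2 * K * L / Real.log z) :=
    mul_le_mul hVz hSGle hSG0 (div_nonneg hCV hlogz.le)
  -- (1) the sieve step
  have h1 := abs_sigma1_sub_model_le A hK (m + 2) (y := y) hx1 hz hzs
  have hexp : Real.exp (-(Real.log (z ^ s) / Real.log z)) = Real.exp (-s) := by
    rw [Real.log_rpow hz0, mul_div_assoc, div_self hlogz.ne', mul_one]
  rw [hexp, ← hP, ← hD, ← hV, ← hCF] at h1
  have hRR := weightedRemainders_le A hsize (m + 2) (y := y) (z := z) (D₀ := z ^ s) hx1 hΓ hL'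
    hsmall hbig ht₀N
  simp only [e1] at hRR
  rw [← hP, ← hD] at hRR
  -- (2) the model sum against `x V Mg`
  have h2 := abs_model_sub_le A hK (k := m + 2) (by omega) (y := y) (z := z) hx hyx
  simp only [e1] at h2
  rw [← hP, ← hD, ← hV] at h2
  -- (3) the oscillation (Lemma 9 replaced)
  have h3 := abs_sum_moebius_mul_density_sub_inv_le A.density A.density_mult hg0 (m + 2) hz hx1
    hyx hosc
  rw [← hP, ← hD] at h3
  -- (4) `V ↦ H P(z)`
  have h4 := abs_main_sub_mainTermF_le A H (m + 2) (y := y) (z := z) hx1 hyx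
  rw [← hP, ← hD, ← hV, ← hPz] at h4
  -- `Mg = Δ + Sr`
  have hsplit : Mg = Δ + Sr := by
    rw [hMg, hΔ, hSr, ← Finset.sum_add_distrib]
    exact Finset.sum_congr rfl fun d _ => by ring
  -- the chain of triangle inequalities
  have hchain : |sigma1 A (m + 2) x y z - H * x * mainTermF (m + 2) x y z| ≤
      |sigma1 A (m + 2) x y z - V * M| + |V * M - x * V * Mg| + x * V * |Δ| +
        |x * V * Sr - H * x * mainTermF (m + 2) x y z| := by
    have e : sigma1 A (m + 2) x y z - H * x * mainTermF (m + 2) x y z =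
        (sigma1 A (m + 2) x y z - V * M) + (V * M - x * V * Mg) + x * V * Δ +
          (x * V * Sr - H * x * mainTermF (m + 2) x y z) := by rw [hsplit]; ring
    rw [e]
    refine (abs_add_le _ _).trans (add_le_add ((abs_add_three _ _ _).trans
      (add_le_add le_rfl (le_of_eq ?_))) le_rfl)
    rw [abs_mul, abs_of_nonneg (mul_nonneg hx0.le hV0)]
  refine hchain.trans ?_
  -- bound each of the four terms
  have hB1 : |sigma1 A (m + 2) x y z - V * M| ≤
      2 * K * CF * CV * Real.exp (-s) * x * L ^ (m + 1) * (L / Real.log z) ^ 2 +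
        (L ^ (m + 2) * Rbig + ↑(m + 2) * L ^ (m + 1) * (Γ * t₀ + Rbig * Real.log ⌊x⌋₊)) := by
    refine h1.trans (add_le_add ?_ hRR)
    calc CF * Real.exp (-s) * V * (x * L ^ (m + 2)) * SG
        = CF * Real.exp (-s) * (x * L ^ (m + 2)) * (V * SG) := by ring
      _ ≤ CF * Real.exp (-s) * (x * L ^ (m + 2)) * ((CV / Real.log z) * (2 * K * L / Real.log z)) :=
          mul_le_mul_of_nonneg_left hVSG (by positivity)
      _ = 2 * K * CF * CV * Real.exp (-s) * x * L ^ (m + 1) * (L / Real.log z) ^ 2 := by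
          field_simp; ring
  have hB2 : |V * M - x * V * Mg| ≤
      2 * K * CV * (2 * ↑(m + 2) + 1) * x * L ^ m * (L / Real.log z) ^ 2 := by
    refine h2.trans ?_
    calc V * ((2 * ↑(m + 2) + 1) * x * L ^ (m + 1)) * SG
        = (2 * ↑(m + 2) + 1) * (x * L ^ (m + 1)) * (V * SG) := by ring
      _ ≤ (2 * ↑(m + 2) + 1) * (x * L ^ (m + 1)) * ((CV / Real.log z) * (2 * K * L / Real.log z)) :=
          mul_le_mul_of_nonneg_left hVSG (by positivity)
      _ = 2 * K * CV * (2 * ↑(m + 2) + 1) * x * L ^ m * (L / Real.log z) ^ 2 := by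
          field_simp; ring
  have hB3 : x * V * |Δ| ≤ 2 * K * Real.exp 5 * CV * η * x * L ^ m * (L / Real.log z) ^ 4 := by
    have hSS : SI * SG ≤ (Real.exp 5 * L / Real.log z) * (2 * K * L / Real.log z) :=
      mul_le_mul hSIle hSGle hSG0 (by positivity)
    have hΔ' : |Δ| ≤ η * (L ^ (m + 2) / Real.log z) *
        ((Real.exp 5 * L / Real.log z) * (2 * K * L / Real.log z)) :=
      h3.trans (mul_le_mul_of_nonneg_left hSS (by positivity))
    calc x * V * |Δ| ≤ x * (CV / Real.log z) * (η * (L ^ (m + 2) / Real.log z) *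
          ((Real.exp 5 * L / Real.log z) * (2 * K * L / Real.log z))) := by
          refine mul_le_mul (mul_le_mul_of_nonneg_left hVz hx0.le) hΔ' (abs_nonneg _) ?_
          positivity
      _ = 2 * K * Real.exp 5 * CV * η * x * L ^ m * (L / Real.log z) ^ 4 := by
          field_simp; ring
  have hB4 : |x * V * Sr - H * x * mainTermF (m + 2) x y z| ≤
      Real.exp 5 * δ'' * x * L ^ (m + 1) * (L / Real.log z) ^ 2 := by
    refine h4.trans ?_
    have hfac : x * |V - H * Pz| * L ^ (m + 2) ≤ x * (δ'' / Real.log z) * L ^ (m + 2) :=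
      mul_le_mul_of_nonneg_right (mul_le_mul_of_nonneg_left hVH hx0.le) (pow_nonneg hL0.le _)
    calc x * |V - H * Pz| * L ^ (m + 2) * SI
        ≤ x * (δ'' / Real.log z) * L ^ (m + 2) * (Real.exp 5 * L / Real.log z) :=
          mul_le_mul hfac hSIle hSI0 (by positivity)
      _ = Real.exp 5 * δ'' * x * L ^ (m + 1) * (L / Real.log z) ^ 2 := by
          field_simp; ring
  linarith [hB1, hB2, hB3, hB4]

/-! ### The level of distribution at integer heights `t ∈ [x^{1−ε/2}, x]` -/

/-- For `x^{1−ε/2} ≤ t ≤ x` (`0 < ε < 1`, `x ≥ 3`) the moduli `q < x^{1−ε}` are within the level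
`t^{1−ε/2}` at height `t`, and `log t ≥ ½ log x`; so the level-of-distribution bound at `t` with
exponent `B = k + 2` bounds the squarefree remainder sum `RS(t)` by `C_R 2^{k+2} x/(log x)^{k+2}`.
[folklore] -/
theorem remainderSum_level_le (A : SieveSequence) {x ε CR : ℝ} (k : ℕ) (hx : 3 ≤ x) (hε : 0 < ε)
    (hε1 : ε < 1) (hCR : 0 ≤ CR) {t : ℕ} (htx : (t : ℝ) ≤ x) (ht : x ^ (1 - ε / 2) ≤ t)
    (hRt : ∑ q ∈ (Icc 1 ⌊(t : ℝ) ^ (1 - ε / 2)⌋₊).filter Squarefree, |A.remainder q (t : ℝ)| ≤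
      CR * t / Real.log t ^ ((k : ℝ) + 2)) :
    ∑ q ∈ (Ico 1 ⌈x ^ (1 - ε)⌉₊).filter Squarefree, |A.remainder q (t : ℝ)| ≤
      CR * 2 ^ (k + 2) * x / Real.log x ^ (k + 2) := by
  have hx0 : 0 < x := by linarith
  have hx1 : 1 ≤ x := by linarith
  have hexp0 : 0 ≤ 1 - ε / 2 := by linarith
  have hxpow : 0 < x ^ (1 - ε / 2) := Real.rpow_pos_of_pos hx0 _
  have ht0 : (0 : ℝ) < t := hxpow.trans_le ht
  have hL : 1 ≤ Real.log x := by
    rw [← Real.log_exp 1]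
    exact Real.log_le_log (Real.exp_pos 1) (le_trans (by
      have := Real.exp_one_lt_d9; norm_num at this ⊢; linarith) hx)
  have hL0 : 0 < Real.log x := by linarith
  -- `x^{1−ε} ≤ t^{1−ε/2}`
  have hlev : x ^ (1 - ε) ≤ (t : ℝ) ^ (1 - ε / 2) := by
    have h1 : (x ^ (1 - ε / 2)) ^ (1 - ε / 2) ≤ (t : ℝ) ^ (1 - ε / 2) :=
      Real.rpow_le_rpow hxpow.le ht hexp0
    have h2 : (x ^ (1 - ε / 2)) ^ (1 - ε / 2) = x ^ ((1 - ε / 2) * (1 - ε / 2)) := by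
      rw [← Real.rpow_mul hx0.le]
    have h3 : x ^ (1 - ε) ≤ x ^ ((1 - ε / 2) * (1 - ε / 2)) :=
      Real.rpow_le_rpow_of_exponent_le hx1 (by nlinarith)
    linarith
  -- `log t ≥ (1 − ε/2) log x ≥ ½ log x`
  have hlogt : Real.log x / 2 ≤ Real.log t := by
    have h1 : Real.log (x ^ (1 - ε / 2)) ≤ Real.log t := Real.log_le_log hxpow ht
    rw [Real.log_rpow hx0] at h1
    nlinarith
  have hlogt0 : 0 < Real.log t := by linarith
  -- the subset of moduli
  have hsub : (Ico 1 ⌈x ^ (1 - ε)⌉₊).filter Squarefree ⊆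
      (Icc 1 ⌊(t : ℝ) ^ (1 - ε / 2)⌋₊).filter Squarefree := by
    intro q hq
    rw [Finset.mem_filter, Finset.mem_Ico] at hq
    rw [Finset.mem_filter, Finset.mem_Icc]
    refine ⟨⟨hq.1.1, Nat.le_floor ?_⟩, hq.2⟩
    have h2 : ((q + 1 : ℕ) : ℝ) ≤ ⌈x ^ (1 - ε)⌉₊ := by exact_mod_cast hq.1.2
    have h3 : (⌈x ^ (1 - ε)⌉₊ : ℝ) < x ^ (1 - ε) + 1 := Nat.ceil_lt_add_one (Real.rpow_nonneg hx0.le _)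
    push_cast at h2
    linarith
  refine (Finset.sum_le_sum_of_subset_of_nonneg hsub fun q _ _ => abs_nonneg _).trans
    (hRt.trans ?_)
  have hpow : Real.log (t : ℝ) ^ ((k : ℝ) + 2) = Real.log t ^ (k + 2) := by
    rw [show ((k : ℝ) + 2) = ((k + 2 : ℕ) : ℝ) by push_cast; ring, Real.rpow_natCast]
  rw [hpow]
  have hden : (Real.log x / 2) ^ (k + 2) ≤ Real.log t ^ (k + 2) :=
    pow_le_pow_left₀ (by positivity) hlogt _
  calc CR * t / Real.log t ^ (k + 2) ≤ CR * x / (Real.log x / 2) ^ (k + 2) := by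
        gcongr
    _ = CR * 2 ^ (k + 2) * x / Real.log x ^ (k + 2) := by
        rw [div_pow]; field_simp

/-- The polylogarithmic factor of `remainderSum_trivial_le` against a single power of `log x`:
for `log x ≥ 1`, `2 √(K_c C_τ (log x)^{C_c} (log x)^8) + 3K log x ≤ (2√(K_c C_τ) + 3K)(log x)^{⌈C_c⌉+8}`.
[folklore] -/
theorem polylog_factor_le {Kc Cτ K Cc L : ℝ} (hKc : 0 ≤ Kc) (hCτ : 0 ≤ Cτ) (hK : 0 ≤ K)
    (hL : 1 ≤ L) :
    2 * Real.sqrt (Kc * Cτ * L ^ Cc * L ^ (2 ^ (2 + 1))) + 3 * K * L ≤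
      (2 * Real.sqrt (Kc * Cτ) + 3 * K) * L ^ (⌈Cc⌉₊ + 8) := by
  have hL0 : 0 ≤ L := by linarith
  have hm : L ^ Cc * L ^ (2 ^ (2 + 1)) ≤ L ^ (⌈Cc⌉₊ + 8) := by
    have h1 : L ^ Cc ≤ L ^ ((⌈Cc⌉₊ : ℕ) : ℝ) :=
      Real.rpow_le_rpow_of_exponent_le hL (Nat.le_ceil Cc)
    rw [Real.rpow_natCast] at h1
    calc L ^ Cc * L ^ (2 ^ (2 + 1)) ≤ L ^ ⌈Cc⌉₊ * L ^ (2 ^ (2 + 1)) :=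
          mul_le_mul_of_nonneg_right h1 (by positivity)
      _ = L ^ (⌈Cc⌉₊ + 8) := by rw [← pow_add]; norm_num
  have hpow1 : 1 ≤ L ^ (⌈Cc⌉₊ + 8) := one_le_pow₀ hL
  have hsq : Real.sqrt (Kc * Cτ * L ^ Cc * L ^ (2 ^ (2 + 1))) ≤
      Real.sqrt (Kc * Cτ) * L ^ (⌈Cc⌉₊ + 8) := by
    calc Real.sqrt (Kc * Cτ * L ^ Cc * L ^ (2 ^ (2 + 1)))
        ≤ Real.sqrt (Kc * Cτ * (L ^ (⌈Cc⌉₊ + 8)) ^ 2) := by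
          refine Real.sqrt_le_sqrt ?_
          rw [mul_assoc (Kc * Cτ)]
          refine mul_le_mul_of_nonneg_left (hm.trans ?_) (by positivity)
          nlinarith
      _ = Real.sqrt (Kc * Cτ) * L ^ (⌈Cc⌉₊ + 8) := by
          rw [Real.sqrt_mul (by positivity), Real.sqrt_sq (by positivity)]
  have hlin : L ≤ L ^ (⌈Cc⌉₊ + 8) := by
    calc L = L ^ 1 := (pow_one L).symm
      _ ≤ L ^ (⌈Cc⌉₊ + 8) := pow_le_pow_right₀ hL (by omega)
  nlinarith [Real.sqrt_nonneg (Kc * Cτ)]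

/-! ### The four small error terms: pure arithmetic -/

/-- `T₃`: `2K C_V a x L^m r² ≤ (δ/4) x L^{m+1}` once `r ≤ 1/ν` and `8 K C_V a/(ν² δ) ≤ L`. [folklore] -/
theorem numT3 {K CV a δ ν L x r : ℝ} (m : ℕ) (hK : 0 ≤ K) (hCV : 0 ≤ CV) (ha : 0 ≤ a)
    (hδ : 0 < δ) (hν : 0 < ν) (hL : 0 < L) (hx : 0 < x) (hr0 : 0 ≤ r) (hr : r ≤ ν⁻¹)
    (h4 : 8 * K * CV * a / (ν ^ 2 * δ) ≤ L) :
    2 * K * CV * a * x * L ^ m * r ^ 2 ≤ δ / 4 * x * L ^ (m + 1) := by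
  have hr2 : r ^ 2 ≤ (ν⁻¹) ^ 2 := pow_le_pow_left₀ hr0 hr 2
  rw [div_le_iff₀ (by positivity)] at h4
  have h3 : 2 * K * CV * a * (ν⁻¹) ^ 2 ≤ δ / 4 * L := by
    rw [inv_pow, ← div_eq_mul_inv, div_le_iff₀ (by positivity)]
    nlinarith
  calc 2 * K * CV * a * x * L ^ m * r ^ 2 ≤ 2 * K * CV * a * x * L ^ m * (ν⁻¹) ^ 2 :=
        mul_le_mul_of_nonneg_left hr2 (by positivity)
    _ = (2 * K * CV * a * (ν⁻¹) ^ 2) * (x * L ^ m) := by ring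
    _ ≤ (δ / 4 * L) * (x * L ^ m) := mul_le_mul_of_nonneg_right h3 (by positivity)
    _ = δ / 4 * x * L ^ (m + 1) := by ring

/-- `T₄`: `E η x L^m r⁴ ≤ (δ/4) x L^{m+1}` for `η = δ ν⁴/(4E)`, `r ≤ 1/ν`, `L ≥ 1`. [folklore] -/
theorem numT4 {E δ ν L x r : ℝ} (m : ℕ) (hE : 0 < E) (hδ : 0 < δ) (hν : 0 < ν) (hL : 1 ≤ L)
    (hx : 0 < x) (hr0 : 0 ≤ r) (hr : r ≤ ν⁻¹) :
    E * (δ * ν ^ 4 / (4 * E)) * x * L ^ m * r ^ 4 ≤ δ / 4 * x * L ^ (m + 1) := by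
  have hr4 : r ^ 4 ≤ (ν⁻¹) ^ 4 := pow_le_pow_left₀ hr0 hr 4
  have h1 : E * (δ * ν ^ 4 / (4 * E)) = δ * ν ^ 4 / 4 := by field_simp
  rw [h1]
  have hL0 : 0 < L := by linarith
  calc δ * ν ^ 4 / 4 * x * L ^ m * r ^ 4 ≤ δ * ν ^ 4 / 4 * x * L ^ m * (ν⁻¹) ^ 4 :=
        mul_le_mul_of_nonneg_left hr4 (by positivity)
    _ = δ / 4 * x * L ^ m * 1 := by field_simp
    _ ≤ δ / 4 * x * L ^ m * L := mul_le_mul_of_nonneg_left hL (by positivity)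
    _ = δ / 4 * x * L ^ (m + 1) := by ring

/-- `T₅`: `E δ'' x L^{m+1} r² ≤ (δ/4) x L^{m+1}` for `δ'' = δ ν²/(4E)`, `r ≤ 1/ν`. [folklore] -/
theorem numT5 {E δ ν L x r : ℝ} (m : ℕ) (hE : 0 < E) (hδ : 0 < δ) (hν : 0 < ν) (hL : 0 < L)
    (hx : 0 < x) (hr0 : 0 ≤ r) (hr : r ≤ ν⁻¹) :
    E * (δ * ν ^ 2 / (4 * E)) * x * L ^ (m + 1) * r ^ 2 ≤ δ / 4 * x * L ^ (m + 1) := by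
  have hr2 : r ^ 2 ≤ (ν⁻¹) ^ 2 := pow_le_pow_left₀ hr0 hr 2
  have h1 : E * (δ * ν ^ 2 / (4 * E)) = δ * ν ^ 2 / 4 := by field_simp
  rw [h1]
  calc δ * ν ^ 2 / 4 * x * L ^ (m + 1) * r ^ 2 ≤ δ * ν ^ 2 / 4 * x * L ^ (m + 1) * (ν⁻¹) ^ 2 :=
        mul_le_mul_of_nonneg_left hr2 (by positivity)
    _ = δ / 4 * x * L ^ (m + 1) := by field_simp

/-- `T₂` (the remainders): with `R_big = C_R 2^{m+4} x/L^{m+4}`, `Γ = C_Γ L^{m₀}`,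
`t₀ ≤ 2 x_e` (`x_e = x^{1−ε/2}`), `log N ≤ L`, `12((m+2)+1) C_R 2^{m+4} ≤ δ L^{m+3}` and
`L^{m₀} x_e ≤ (δ/(24 (m+2) C_Γ)) x`:
`L^{m+2} R_big + (m+2) L^{m+1} (Γ t₀ + R_big log N) ≤ (δ/4) x L^{m+1}`. [folklore] -/
theorem numT2 {CR CΓ δ L x xe t₀ lN : ℝ} (m m₀ : ℕ) (hCR : 0 ≤ CR) (hCΓ : 0 < CΓ) (hδ : 0 < δ)
    (hL : 1 ≤ L) (hx : 0 < x) (ht₀x : t₀ ≤ 2 * xe) (hlN : lN ≤ L) (h6 : 12 * (((m + 2 : ℕ) : ℝ) + 1) * CR * 2 ^ (m + 2 + 2) ≤ δ * L ^ (m + 2 + 1))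
    (h5 : L ^ m₀ * xe ≤ δ / (24 * ((m + 2 : ℕ) : ℝ) * CΓ) * x) :
    L ^ (m + 2) * (CR * 2 ^ (m + 2 + 2) * x / L ^ (m + 2 + 2)) +
        ((m + 2 : ℕ) : ℝ) * L ^ (m + 1) *
          (CΓ * L ^ m₀ * t₀ + CR * 2 ^ (m + 2 + 2) * x / L ^ (m + 2 + 2) * lN) ≤
      δ / 4 * x * L ^ (m + 1) := by
  have hL0 : 0 < L := by linarith
  have hk0 : (0 : ℝ) < ((m + 2 : ℕ) : ℝ) := by positivity
  set k : ℝ := ((m + 2 : ℕ) : ℝ) with hk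
  -- (a)
  have ha : L ^ (m + 2) * (CR * 2 ^ (m + 2 + 2) * x / L ^ (m + 2 + 2)) ≤ δ / 12 * x * L ^ (m + 1) := by
    have e : L ^ (m + 2) * (CR * 2 ^ (m + 2 + 2) * x / L ^ (m + 2 + 2)) =
        (CR * 2 ^ (m + 2 + 2)) * x / L ^ 2 := by
      field_simp; ring
    rw [e, div_le_iff₀ (by positivity)]
    have h6' : CR * 2 ^ (m + 2 + 2) * 12 ≤ δ * L ^ (m + 2 + 1) := by
      have : (0:ℝ) ≤ k * CR * 2 ^ (m + 2 + 2) := by positivity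
      nlinarith
    calc CR * 2 ^ (m + 2 + 2) * x = (CR * 2 ^ (m + 2 + 2) * 12) * x / 12 := by ring
      _ ≤ (δ * L ^ (m + 2 + 1)) * x / 12 := by gcongr
      _ = δ / 12 * x * L ^ (m + 1) * L ^ 2 := by ring
  -- (b)
  have hb : k * L ^ (m + 1) * (CR * 2 ^ (m + 2 + 2) * x / L ^ (m + 2 + 2) * lN) ≤
      δ / 12 * x * L ^ (m + 1) := by
    have h1 : k * L ^ (m + 1) * (CR * 2 ^ (m + 2 + 2) * x / L ^ (m + 2 + 2) * lN) ≤
        k * L ^ (m + 1) * (CR * 2 ^ (m + 2 + 2) * x / L ^ (m + 2 + 2) * L) :=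
      mul_le_mul_of_nonneg_left (mul_le_mul_of_nonneg_left hlN (by positivity)) (by positivity)
    refine h1.trans ?_
    have e : k * L ^ (m + 1) * (CR * 2 ^ (m + 2 + 2) * x / L ^ (m + 2 + 2) * L) =
        (k * CR * 2 ^ (m + 2 + 2)) * x / L ^ 2 := by
      field_simp; ring
    rw [e, div_le_iff₀ (by positivity)]
    have h6' : k * CR * 2 ^ (m + 2 + 2) * 12 ≤ δ * L ^ (m + 2 + 1) := by
      have : (0:ℝ) ≤ CR * 2 ^ (m + 2 + 2) := by positivity
      nlinarith
    calc k * CR * 2 ^ (m + 2 + 2) * x = (k * CR * 2 ^ (m + 2 + 2) * 12) * x / 12 := by ring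
      _ ≤ (δ * L ^ (m + 2 + 1)) * x / 12 := by gcongr
      _ = δ / 12 * x * L ^ (m + 1) * L ^ 2 := by ring
  -- (c)
  have hc : k * L ^ (m + 1) * (CΓ * L ^ m₀ * t₀) ≤ δ / 12 * x * L ^ (m + 1) := by
    calc k * L ^ (m + 1) * (CΓ * L ^ m₀ * t₀)
        ≤ k * L ^ (m + 1) * (CΓ * L ^ m₀ * (2 * xe)) :=
          mul_le_mul_of_nonneg_left (mul_le_mul_of_nonneg_left ht₀x (by positivity)) (by positivity)
      _ = k * L ^ (m + 1) * (2 * CΓ) * (L ^ m₀ * xe) := by ring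
      _ ≤ k * L ^ (m + 1) * (2 * CΓ) * (δ / (24 * k * CΓ) * x) :=
          mul_le_mul_of_nonneg_left h5 (by positivity)
      _ = δ / 12 * x * L ^ (m + 1) := by field_simp; ring
  have hsum : k * L ^ (m + 1) * (CΓ * L ^ m₀ * t₀ + CR * 2 ^ (m + 2 + 2) * x / L ^ (m + 2 + 2) * lN) =
      k * L ^ (m + 1) * (CΓ * L ^ m₀ * t₀) +
        k * L ^ (m + 1) * (CR * 2 ^ (m + 2 + 2) * x / L ^ (m + 2 + 2) * lN) := by ring
  rw [hsum]
  linarith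

/-! ### [FriedlanderIwaniecPisa1978] Lemma 12 under the tree hypotheses -/

/-- **[FriedlanderIwaniecPisa1978] Lemma 12 under the hypotheses of `Literature.NumberTheory.Sieve.bombieri_asymptotic_sieve`**
(size `X(x) = x`, `HasSieveDimension g 1 K`, `HasLinearDensity c`, `HasDensityConstant H`, level `x^θ`
for every `θ < 1` on squarefree moduli, `∑ a_n² ≪ x (log x)^C`), in the shape consumed by the
assembly of the theorem: there is `C` such that for all `ε > 0`, `s ≥ 2`, `ν > 0`, `δ > 0`, all
large `x` and all `y, z` with `z ≥ 2`, `z ≥ x^ν`, `y ≥ 1`, `z^s y ≤ x^{1−ε}`,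
`|Σ₁ − H x F| ≤ C e^{−s} x (log x)^{k−1} (log x/log z)² + δ x (log x)^{k−1}`.
The proof is that of pp. 738–739 with three changes forced by the hypotheses: the model size of the
weighted subsequences is the integer sum `Φ_d(x) = ∑_{n ≤ x} (log⁺ n/d)^k` (`X(x) = x`); the
remainders are bounded by Abel summation in SUM form over the heights `t ≤ x`, using the level of
distribution at `t` for `t ≥ x^{1−ε/2}` (`remainderSum_level_le`) and the trivial bound
(Cauchy–Schwarz with `∑ a_n²` and `∑ τ(n)²`, `remainderSum_trivial_le`) below; and Lemma 9 is
replaced by the oscillatory estimate `abs_sum_moebius_mul_density_sub_inv_le`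
(`BombieriAsymptoticSieveOscillation.lean`), fed by `eventually_oscillation_le`, while `V(z)` is
compared with `H P(z)` directly through `HasDensityConstant` (`eventually_abs_densityProduct_sub_le`).
All of this is `sigma1_bound_at`; here the error terms are made `≤ δ x (log x)^{k−1}` for large `x`
(`numT2`–`numT5`). [cite: FriedlanderIwaniecPisa1978, Lemma 12] -/
theorem treeLemma12 (k : ℕ) (hk : 2 ≤ k) (A : SieveSequence) (H c : ℝ) (hsize : ∀ x, A.size x = x)
    (hdim : ∃ K : ℝ, HasSieveDimension A.density 1 K) (hlin : A.HasLinearDensity c)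
    (hH : A.HasDensityConstant H) (hlevel : ∀ θ : ℝ, θ < 1 → HasLevelOfDistribution A θ)
    (hcrude : ∃ C : ℝ, (fun x : ℝ => ∑ n ∈ Ioc 0 ⌊x⌋₊, A.a n ^ 2) =O[atTop]
      fun x : ℝ => x * Real.log x ^ C) :
    ∃ C : ℝ, ∀ ε : ℝ, 0 < ε → ∀ s : ℝ, 2 ≤ s → ∀ ν : ℝ, 0 < ν → ∀ δ : ℝ, 0 < δ →
      ∀ᶠ x : ℝ in atTop, ∀ y z : ℝ, 2 ≤ z → x ^ ν ≤ z → 1 ≤ y → z ^ s * y ≤ x ^ (1 - ε) →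
        |sigma1 A k x y z - H * x * mainTermF k x y z| ≤
          C * Real.exp (-s) * x * Real.log x ^ (k - 1) * (Real.log x / Real.log z) ^ 2 +
            δ * x * Real.log x ^ (k - 1) := by
  obtain ⟨m, rfl⟩ : ∃ m, k = m + 2 := ⟨k - 2, by omega⟩
  have e1 : m + 2 - 1 = m + 1 := by omega
  have e2 : m + 2 - 2 = m := by omega
  simp only [e1]
  obtain ⟨K, hK⟩ := hdim
  have hK1 : 1 ≤ K := hK.one_le
  obtain ⟨CV, hCV0, hV⟩ := exists_densityProduct_le A hH
  obtain ⟨Cc, hCc0, Kc, hKc0, hcr⟩ := crude_bound A hcrude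
  obtain ⟨Cτ, hCτ0, hτ⟩ := exists_sum_sigma_zero_pow_le_real 2
  refine ⟨2 * K * SieveSequence.flConst 1 K * CV, fun ε hε s hs ν hν δ hδ => ?_⟩
  -- the statement is vacuous unless `ε < 1`
  by_cases hε1 : 1 ≤ ε
  · filter_upwards [eventually_ge_atTop (1 : ℝ)] with x hx1 y z hz hxz hy1 hzsy
    exfalso
    have hz1 : (1 : ℝ) ≤ z := by linarith
    have hzs : z ≤ z ^ s := by
      conv_lhs => rw [← Real.rpow_one z]
      exact Real.rpow_le_rpow_of_exponent_le hz1 (by linarith)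
    have h1 : x ^ (1 - ε) ≤ 1 := Real.rpow_le_one_of_one_le_of_nonpos hx1 (by linarith)
    have h2 : z ^ s ≤ z ^ s * y := le_mul_of_one_le_right (by linarith) hy1
    linarith
  push Not at hε1
  -- constants depending on `ε, s, ν, δ`
  obtain ⟨CR, hCR0, hR⟩ := level_bound A hsize hlevel (half_pos hε) (((m + 2 : ℕ) : ℝ) + 2)
  obtain ⟨TR, hTR⟩ := Filter.eventually_atTop.mp hR
  set E4 : ℝ := 2 * K * Real.exp 5 * CV with hE4
  have hE4pos : 0 < E4 := by positivity
  have hη0 : 0 < δ * ν ^ 4 / (4 * E4) := by positivity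
  obtain ⟨Z₀, hZ₀⟩ := Filter.eventually_atTop.mp (eventually_oscillation_le A hlin hη0)
  have hδ''0 : 0 < δ * ν ^ 2 / (4 * Real.exp 5) := by positivity
  obtain ⟨Z₁, hZ₁⟩ := Filter.eventually_atTop.mp (eventually_abs_densityProduct_sub_le A hH hδ''0)
  set CΓ : ℝ := 2 * Real.sqrt (Kc * Cτ) + 3 * K with hCΓ
  have hCΓ0 : 0 < CΓ := by positivity
  set m₀ : ℕ := ⌈Cc⌉₊ + 8 with hm₀
  set kR : ℝ := ((m + 2 : ℕ) : ℝ) with hkR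
  have hkR0 : 0 < kR := by positivity
  -- eventual conditions on `x`
  have ev2 : ∀ᶠ x : ℝ in atTop, TR ≤ x ^ (1 - ε / 2) :=
    (tendsto_rpow_atTop (by linarith : 0 < 1 - ε / 2)).eventually_ge_atTop TR
  have ev3 : ∀ᶠ x : ℝ in atTop, max Z₀ Z₁ ≤ x ^ ν := (tendsto_rpow_atTop hν).eventually_ge_atTop _
  have ev4 : ∀ᶠ x : ℝ in atTop, 8 * K * CV * (2 * kR + 1) / (ν ^ 2 * δ) ≤ Real.log x :=
    Real.tendsto_log_atTop.eventually_ge_atTop _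
  have ev5 : ∀ᶠ x : ℝ in atTop, Real.log x ^ (m₀ : ℝ) / x ^ (ε / 2) ≤ δ / (24 * kR * CΓ) := by
    have hlo := (isLittleO_log_rpow_rpow_atTop (m₀ : ℝ) (half_pos hε)).tendsto_div_nhds_zero
    exact ((tendsto_order.1 hlo).2 _ (by positivity)).mono fun x hx => hx.le
  have ev6 : ∀ᶠ x : ℝ in atTop, 12 * (kR + 1) * CR * 2 ^ (m + 2 + 2) / δ ≤ Real.log x ^ (m + 2 + 1) :=
    ((tendsto_pow_atTop (by omega : m + 2 + 1 ≠ 0)).comp Real.tendsto_log_atTop).eventually_ge_atTop _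
  have ev7 : ∀ᶠ x : ℝ in atTop, (2 : ℝ) ≤ x ^ (ε / 2) :=
    (tendsto_rpow_atTop (half_pos hε)).eventually_ge_atTop _
  filter_upwards [ev2, ev3, ev4, ev5, ev6, ev7, eventually_ge_atTop (4 : ℝ)]
    with x hxTR hxZ hxL4 hx5 hx6 hx7 hx4 y z hz hxz hy1 hzsy
  -- basic facts at this `x`
  have hx0 : 0 < x := by linarith
  have hx1 : 1 < x := by linarith
  have hx2 : 2 ≤ x := by linarith
  have hx3 : 3 ≤ x := by linarith
  have hL1 : 1 ≤ Real.log x := by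
    rw [← Real.log_exp 1]
    exact Real.log_le_log (Real.exp_pos 1) (le_trans (by
      have := Real.exp_one_lt_d9; norm_num at this ⊢; linarith) hx3)
  have hL0 : 0 < Real.log x := by linarith
  have hz0 : 0 < z := by linarith
  have hz1 : 1 < z := by linarith
  have hlogz : 0 < Real.log z := Real.log_pos hz1
  have hzs1 : z ≤ z ^ s := by
    conv_lhs => rw [← Real.rpow_one z]
    exact Real.rpow_le_rpow_of_exponent_le hz1.le (by linarith)
  have hzs0 : 0 < z ^ s := by linarith
  have hxε : x ^ (1 - ε) ≤ x := by
    calc x ^ (1 - ε) ≤ x ^ (1 : ℝ) := Real.rpow_le_rpow_of_exponent_le hx1.le (by linarith)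
      _ = x := Real.rpow_one x
  have hyx : y ≤ x := by
    have : y ≤ z ^ s * y := le_mul_of_one_le_left (by linarith) (by linarith)
    linarith
  have hzx : z ≤ x := by
    have : z ^ s ≤ z ^ s * y := le_mul_of_one_le_right hzs0.le hy1
    linarith
  have hZ₀z : Z₀ ≤ z := le_trans (le_trans (le_max_left _ _) hxZ) hxz
  have hZ₁z : Z₁ ≤ z := le_trans (le_trans (le_max_right _ _) hxZ) hxz
  -- `L / log z ≤ 1/ν`
  have hνL : ν * Real.log x ≤ Real.log z := by
    have := Real.log_le_log (Real.rpow_pos_of_pos hx0 ν) hxz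
    rwa [Real.log_rpow hx0] at this
  have hratio : Real.log x / Real.log z ≤ ν⁻¹ := by
    rw [div_le_iff₀ hlogz, ← div_eq_inv_mul, le_div_iff₀ hν]
    linarith
  have hratio0 : 0 ≤ Real.log x / Real.log z := by positivity
  -- the parameters of the remainder treatment
  set t₀ : ℕ := ⌈x ^ (1 - ε / 2)⌉₊ with ht₀
  have hxpow : 0 < x ^ (1 - ε / 2) := Real.rpow_pos_of_pos hx0 _
  have ht₀lt : (t₀ : ℝ) < x ^ (1 - ε / 2) + 1 := Nat.ceil_lt_add_one hxpow.le
  have ht₀ge : x ^ (1 - ε / 2) ≤ t₀ := Nat.le_ceil _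
  have hsplit : x ^ (1 - ε / 2) * x ^ (ε / 2) = x := by rw [← Real.rpow_add hx0]; norm_num
  have hxhalf : x ^ (1 - ε / 2) ≤ x / 2 := by
    rw [le_div_iff₀ two_pos]
    calc x ^ (1 - ε / 2) * 2 ≤ x ^ (1 - ε / 2) * x ^ (ε / 2) :=
          mul_le_mul_of_nonneg_left hx7 hxpow.le
      _ = x := hsplit
  have ht₀N : t₀ ≤ ⌊x⌋₊ := Nat.le_floor (by linarith)
  have ht₀x : (t₀ : ℝ) ≤ 2 * x ^ (1 - ε / 2) := by
    have : 1 ≤ x ^ (1 - ε / 2) := Real.one_le_rpow hx1.le (by linarith)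
    linarith
  -- the level: all moduli `d z^s`, `d < ⌈y⌉` rough, are `< x^{1−ε}`
  have hL' : ∀ d ∈ (Ico 1 ⌈y⌉₊).filter (fun d : ℕ => d.Coprime (primesProdBelow z)),
      (d : ℝ) * z ^ s < x ^ (1 - ε) := by
    intro d hd
    have hd := (Finset.mem_filter.mp hd).1
    have hdy : (d : ℝ) < y := by
      have h2 : ((d + 1 : ℕ) : ℝ) ≤ ⌈y⌉₊ := by exact_mod_cast (Finset.mem_Ico.mp hd).2
      have h3 : (⌈y⌉₊ : ℝ) < y + 1 := Nat.ceil_lt_add_one (by linarith)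
      push_cast at h2; linarith
    calc (d : ℝ) * z ^ s < y * z ^ s := mul_lt_mul_of_pos_right hdy hzs0
      _ = z ^ s * y := mul_comm _ _
      _ ≤ x ^ (1 - ε) := hzsy
  -- the trivial bound below `t₀`
  have hQ : ((⌈x ^ (1 - ε)⌉₊ : ℕ) : ℝ) ≤ x + 1 := by
    have := Nat.ceil_lt_add_one (Real.rpow_nonneg hx0.le (1 - ε))
    linarith
  have hsmall : ∀ t : ℕ, 1 ≤ t → t < t₀ →
      ∑ q ∈ (Ico 1 ⌈x ^ (1 - ε)⌉₊).filter Squarefree, |A.remainder q (t : ℝ)| ≤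
        t * (CΓ * Real.log x ^ m₀) := by
    intro t ht1 htt
    have htx : (t : ℝ) ≤ x := by
      have h1 : ((t + 1 : ℕ) : ℝ) ≤ t₀ := by exact_mod_cast htt
      push_cast at h1
      have : x ^ (1 - ε / 2) ≤ x := by linarith
      linarith
    refine (remainderSum_trivial_le A hK hsize hx2 hQ hKc0 hCc0 hCτ0 hcr hτ ht1 htx).trans ?_
    refine mul_le_mul_of_nonneg_left ?_ (Nat.cast_nonneg t)
    exact polylog_factor_le hKc0.le hCτ0.le (by linarith) hL1
  -- the level bound on `[t₀, ⌊x⌋]`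
  have hbig : ∀ t : ℕ, t₀ ≤ t → t ≤ ⌊x⌋₊ →
      ∑ q ∈ (Ico 1 ⌈x ^ (1 - ε)⌉₊).filter Squarefree, |A.remainder q (t : ℝ)| ≤
        CR * 2 ^ (m + 2 + 2) * x / Real.log x ^ (m + 2 + 2) := by
    intro t htt htN
    have httx : (t : ℝ) ≤ x := (Nat.cast_le.mpr htN).trans (Nat.floor_le hx0.le)
    have htge : x ^ (1 - ε / 2) ≤ t := ht₀ge.trans (by exact_mod_cast htt)
    have hRt := hTR (t : ℝ) (hxTR.trans htge)
    exact remainderSum_level_le A (m + 2) hx3 hε hε1 hCR0.le httx htge hRt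
  -- Lemma 12 at this height
  have hmain := sigma1_bound_at A hK hsize H (k := m + 2) (by omega) (y := y) hx2 hz hzx hyx
    (by linarith : (1 : ℝ) ≤ s) hCV0.le hη0.le hδ''0.le (by positivity) (hV z hz) (hZ₁ z hZ₁z)
    (hZ₀ z hZ₀z) hL' hsmall hbig ht₀N
  simp only [e1, e2] at hmain
  refine hmain.trans ?_
  -- the four `δ`-terms
  have hT3 := numT3 (a := 2 * kR + 1) (x := x) (r := Real.log x / Real.log z) m (by linarith)
    hCV0.le (by positivity) hδ hν hL0 hx0 hratio0 hratio hxL4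
  have hT4 := numT4 (E := E4) (x := x) (r := Real.log x / Real.log z) m hE4pos hδ hν hL1 hx0 hratio0
    hratio
  have hT5 := numT5 (E := Real.exp 5) (x := x) (r := Real.log x / Real.log z) m (Real.exp_pos 5) hδ
    hν hL0 hx0 hratio0 hratio
  have hlogN : Real.log ⌊x⌋₊ ≤ Real.log x := by
    have hN1 : (1 : ℝ) ≤ ⌊x⌋₊ := by
      exact_mod_cast Nat.le_floor (show ((1 : ℕ) : ℝ) ≤ x by push_cast; linarith)
    exact Real.log_le_log (by linarith) (Nat.floor_le hx0.le)
  have h6 : 12 * (kR + 1) * CR * 2 ^ (m + 2 + 2) ≤ δ * Real.log x ^ (m + 2 + 1) := by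
    rw [div_le_iff₀ hδ] at hx6; linarith
  have h5 : Real.log x ^ m₀ * x ^ (1 - ε / 2) ≤ δ / (24 * kR * CΓ) * x := by
    have hxe : 0 < x ^ (ε / 2) := Real.rpow_pos_of_pos hx0 _
    rw [div_le_iff₀ hxe] at hx5
    calc Real.log x ^ m₀ * x ^ (1 - ε / 2) = Real.log x ^ (m₀ : ℝ) * x ^ (1 - ε / 2) := by
          rw [Real.rpow_natCast]
      _ ≤ (δ / (24 * kR * CΓ) * x ^ (ε / 2)) * x ^ (1 - ε / 2) :=
          mul_le_mul_of_nonneg_right hx5 hxpow.le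
      _ = δ / (24 * kR * CΓ) * x := by rw [mul_assoc, mul_comm (x ^ (ε / 2)), hsplit]
  have hT2 := numT2 (L := Real.log x) (x := x) (xe := x ^ (1 - ε / 2)) (t₀ := (t₀ : ℝ))
    (lN := Real.log ⌊x⌋₊) m m₀ hCR0.le hCΓ0 hδ hL1 hx0 ht₀x hlogN h6 h5
  rw [hE4] at hT4
  linarith [hT2, hT3, hT4, hT5]

end BombieriSieve

end Literature.NumberTheory.Sieve
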